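import Literature.Barriers.CriticalPhenomena.PlaquetteWalkHoleRootContinuityZeros
import Literature.Barriers.CriticalPhenomena.PlaquetteWalkHoleRootLetterLaws
import HarnessLib

/-!
# Barrier catalogue (SAWScalingLimit): KILL-FORCED CONTINUITY ZEROS of the Yang–Baxter vertex functional at the far
cell of a hole root — two combinatorial «honeycomb kills» of opposite routes at the two hexagonal angles force an
EXACT zero of the defect at an intermediate angle, with both routes wound and no symmetry of the domain

Composition of two catalogue entries. The FAR-CELL LAW with its honeycomb-point editions
(`PlaquetteWalkHoleRootFarCellLaw`: for a hole root in the `W`-normalisation — root on the `W` side of the root plaquette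
`w`, hole `holeFaceW w = (w.1 − 1, w.2) ∉ D`, far cell `farW w = (w.1 − 2, w.2) ∈ D` — the printed vertex functional at
the far cell is `i·v(θ)·(M_N(θ) − M_S(θ))`; at `θ = π/3` (`w₂ = 0`) the route mass of a route all of whose wound walks
pass some rhombus twice through its two `(π − θ)`-corners VANISHES («`w₂`-kill») while a route with one `w₂`-free wound
walk has positive mass; at `θ = 2π/3` (`w₁ = 0`) the same with the two `θ`-corners («`w₁`-kill»)) and the CONTINUITY
ZEROS (`PlaquetteWalkHoleRootContinuityZeros`: a weak sign change of `Im VF` between two printed angles forces an exact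
zero in between, strictly inside when the end values are non-zero). Put together:

* §1 (signs at the hexagonal angle `θ = π/3`) `im_vertexFunctional_printed_farCellW_pi_div_three_eq` —
  `Im VF(π/3) = x_c²·(M_N − M_S)`; ★ `…_pi_div_three_pos_of_under_killed` / `…_neg_of_over_killed` — an under-route
  `w₂`-kill with a `w₂`-free wound over-walk makes `Im VF(π/3) > 0`, the mirror-route configuration makes it `< 0`;
* §2 (signs at the dual angle `θ = 2π/3`) ★ `…_two_pi_div_three_pos_of_under_killed` / `…_neg_of_over_killed` — the
  `w₁`-twins;
* §3 (two strict signs) `vertexFunctional_printed_farCellW_exists_eq_zero_Ioo_of_im_pos_of_im_neg` / `…_of_im_neg_of_im_pos`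
  — strict opposite signs of `Im VF` at two printed angles put an exact zero in the OPEN interval;
* §4 ★★★ **KILL-FORCED ZEROS** `vertexFunctional_printed_farCellW_exists_eq_zero_Ioo_of_opposite_kills` — if at the
  far cell EVERY wound under-walk is `w₂`-marked and SOME wound over-walk is `w₂`-free (honeycomb point), while EVERY
  wound over-walk is `w₁`-marked and SOME wound under-walk is `w₁`-free (dual point), then the Yang–Baxter vertex
  functional of the hole root vanishes EXACTLY at some `θ* ∈ (π/3, 2π/3)`; ★★★ `…_of_opposite_kills'` — the configuration
  with the two routes exchanged (`Im VF(π/3) < 0 < Im VF(2π/3)`); ★★ the ONE-KILL forms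
  `…_exists_eq_zero_Ioo_of_im_pos_of_over_killed` / `…_of_under_killed_of_im_neg` (a kill at one hexagonal angle and a
  strict sign at another printed angle);
* §5 `…_routeMass_eq_at_kill_forced_zero` — at such a zero the two route masses BALANCE (`M_N(θ*) = M_S(θ*)`).
* §6 (edition 2: THE LATERAL CELL `latN w = (w.1 − 1, w.2 + 1)` above the hole, where the catalogue's LATERAL-CELL LAW
  `PlaquetteWalkHoleRootLateralCellLaw` gives `VF = i·v(θ)·e^{i(3θ/8 + 5π/8)}·(M_W − M_E)` and its honeycomb edition the
  `π/3` kills) `ΩG.sum_routeMassL_two_pi_div_three_eq_zero_of_killed` / `…_pos_of_free` (the dual-point twins for the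
  lateral route masses), `routeMassL_diff_pi_div_three_pos_of_east_killed` / `…_neg_of_west_killed`,
  `routeMassL_diff_two_pi_div_three_pos_of_east_killed` / `…_neg_of_west_killed` (signs of `M_W − M_E` from kills),
  ★★★ `vertexFunctional_printed_latN_exists_eq_zero_Ioo_of_opposite_kills` — EAST route `w₂`-killed with a `w₂`-free
  wound WEST-walk at `π/3` and WEST route `w₁`-killed with a `w₁`-free wound EAST-walk at `2π/3` ⇒ an exact zero of the
  lateral defect at some `θ* ∈ (π/3, 2π/3)`; ★★★ `…_of_opposite_kills'` (routes exchanged); `routeMassL_sum_eq_at_kill_forced_zero`.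
* §7 (edition 3: THE LATERAL CELL `latS w = (w.1 − 1, w.2 − 1)` BELOW the hole, in the signed-mass frame of
  `PlaquetteWalkHoleRootContinuityZeros` §E: after rotation by `conj(e^{i·3θ/8})` every class term at `latS` is real,
  `+ext` for a wound walk from `W`, `−ext` from `E`) `signedMassLS_pi_div_three_neg_of_west_killed` /
  `…_pos_of_east_killed`, `signedMassLS_two_pi_div_three_pos_of_east_killed` / `…_neg_of_west_killed`,
  ★★★ `vertexFunctional_printed_latS_exists_eq_zero_Ioo_of_opposite_kills` — WEST route `w₂`-killed with a `w₂`-free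
  wound east-walk at `π/3` and EAST route `w₁`-killed with a `w₁`-free wound west-walk at `2π/3` ⇒ an exact zero BELOW the
  hole in `(π/3, 2π/3)` (the census's first lateral zero is of this kind); ★★★ `…_of_opposite_kills'` (routes exchanged).
* §8 (edition 4: ANY CELL WITH TWO ANTIPODAL LETTERS, in the frame of the catalogue's LETTER LAWS
  `PlaquetteWalkHoleRootLetterLaws`: when the wound class-`B2a` walks at a cell `c` of a `W`-normalised hole root realise
  only the two opposite letters `±u(θ)`, `VF = i·v(θ)·u(θ)·(M(u) − M(−u))`) `letterMass_pi_div_three_eq_zero_of_killed` /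
  `…_pos_of_free`, `letterMass_two_pi_div_three_eq_zero_of_killed` / `…_pos_of_free` (letter masses under kills),
  `re_conj_mul_vertexFunctional_printed_cell_of_antipodal_letters` / `im_…` (the rotated defect `conj(u)·VF` is
  `i·v·‖u‖²·(M(u) − M(−u))`), ★★★ `vertexFunctional_printed_cell_exists_eq_zero_Ioo_of_antipodal_letters_of_opposite_kills`
  — for a CONTINUOUS non-vanishing letter function `u` on `[π/3, 2π/3]`: the `u`-class `w₂`-killed with a `w₂`-free wound
  walk of the `−u`-class at `π/3`, the `−u`-class `w₁`-killed with a `w₁`-free wound walk of the `u`-class at `2π/3` ⇒ an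
  exact zero in `(π/3, 2π/3)` (the rotated line lemma of `PlaquetteWalkHoleRootContinuityZeros` §D); this covers the far
  sides of domino and `2×2` holes and every other two-antipodal-letter cell of the lane's census, where no cell law of the
  catalogue names the two routes.

The point of the entry: the existence of the zero is decided by FOUR FINITE COMBINATORIAL FACTS about the wound walks at
ONE cell (two universal «marked» statements, two existential «free» witnesses) — no evaluation of a mass, no sign
computation, no symmetry of the domain. It is the first enumeration-free SUFFICIENT condition in the catalogue for an
exact zero of the hole-root defect off the honeycomb angles at a cell carrying wound walks of both routes (the mirror
zeros of `PlaquetteWalkHoleRootMirrorZeros` need a row symmetry of the whole domain; the continuity zeros of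
`PlaquetteWalkHoleRootContinuityZeros` need two sign facts, i.e. two mass comparisons).

Why it is recorded (venture lane «pcv-sawmu», HOME `FINDING-YB-KILL-FORCED-ZEROS.md`, b-step0 gen 23; exact
enumeration of the wound class-`B2a` walks at the far cell, hub seconds per domain; instances are DATA of the lane, not
theorems of this file). THE CORNER-KILL TABLE: on the single-hole boxes `5×5 ∖ (2,2)` (root `W` of `(3,2)`, far cell
`(1,2)`), `6×5 ∖ (3,2)` (root `W` of `(4,2)`), `6×5 ∖ (2,2)` (root `W` of `(3,2)`), `5×6 ∖ (2,2)` (root `W` of `(3,2)`)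
the removal of ONE boundary cell kills one route at one hexagonal angle and nothing else, always the same four cells:
the cell `(f.1 − 1, f.2 − 2)` two rows below the far cell's western neighbour `w₂`-kills the UNDER route, its row
mirror `(f.1 − 1, f.2 + 2)` `w₁`-kills the OVER route, the cell `(w.1 + 1, w.2 − 2)` `w₁`-kills the UNDER route and
`(w.1 + 1, w.2 + 2)` `w₂`-kills the OVER route (e.g. `5×5 ∖ {(2,2),(0,0)}`: under-walks 128 wound / 0 `w₂`-free / 56
`w₁`-free, over-walks 128 / 56 / 32; `6×5 ∖ {(3,2),(1,4)}`: over 1024 / 336 / 0, under 1024 / 192 / 392); every other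
single boundary-cell removal leaves both routes free at both angles or empties a route altogether. KILL-FORCED ZEROS WITHOUT
SYMMETRY (the lane's all-angle interval certificate locates the zero and certifies `VF ≠ 0` elsewhere on `[π/3, 2π/3]`):
`6×5 ∖ {(3,2),(1,0),(1,4),(0,1)}` (26 faces, no row symmetry; root `W` of `(4,2)`): over-walks 128 wound / 56 `w₂`-free /
0 `w₁`-free, under-walks 128 / 0 / 56 ⇒ §4 applies, `Im VF(π/3) > 0 > Im VF(2π/3)`; the zero is the only one on the
closed range and lies in `[0.50557·π, 0.50570·π]` — OFF the mirror point; `6×5 ∖ {(3,2),(5,0),(5,4),(0,0)}` (26 faces):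
over 640 / 0 / 80, under 512 / 64 / 0 ⇒ §4′ applies (`Im VF(π/3) < 0 < Im VF(2π/3)`), unique zero in
`[0.37208·π, 0.37225·π]`, far from `π/2`; `6×5 ∖ {(3,2),(5,0),(5,4),(0,4),(0,3)}` (25 faces): over 288 / 0 / 24, under
256 / 48 / 0, unique zero in `[0.62924·π, 0.62939·π]`. The row-symmetric two-cell domains `5×5 ∖ {(2,2),(0,0),(0,4)}`
(over 64 / 28 / 0, under 64 / 0 / 28) and `6×5 ∖ {(3,2),(1,0),(1,4)}` (256 / 112 / 0 and 256 / 0 / 112) are doubly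
explained: mirror zero at `π/2` (`PlaquetteWalkHoleRootMirrorZeros`) AND kill-forced. Not in print in this form (the printed
sources treat simply connected domains, where the vertex relation holds identically); elementary given the two parents.

LATERAL INSTANCE (edition 2): the row mirror of the lane's «route-kill» domain, `6×5 ∖ {(3,2),(0,0),(5,4),(1,4)}` with
the root `W` of `(4,2)`, at the lateral cell `(3,3)`: west-walks 80 wound / 16 `w₂`-free / 0 `w₁`-free, east-walks 960 / 0 / 376 ⇒ §6 applies; the certificate puts
the (unique) zero in `[0.33334·π, 0.33335·π]`, just inside the range — and the census's first lateral-cell zero (the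
original domain `6×5 ∖ {(3,2),(0,4),(5,0),(1,0)}` at the cell `(3,1)` BELOW the hole, `θ* ∈ [0.66665·π, 0.66666·π]`:
east-walks 960 / 376 / 0, west-walks 80 / 0 / 16) is its row-mirror image, a kill-forced zero in the `latS` frame of
`PlaquetteWalkHoleRootContinuityZeros` §E (not restated here).
(Edition 3 types exactly that frame: §7's `…latS_exists_eq_zero_Ioo_of_opposite_kills` has the original domain's
lateral zero as its instance — west-walks 80 wound / 0 `w₂`-free / 16 `w₁`-free, east-walks 960 / 376 / 0.)

References: A. Glazman, I. Manolescu, arXiv:1708.00395v3, Lemma 2.1 and §1 (Fig. 2: «if θ = π/3, then w₂ = 0»; the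
remark after eq. (1)) [GlazmanManolescu2019]; A. Glazman, Electron. Commun. Probab. 20 (2015) no. 86, Lemma 3.1
[Glazman2015WeightedSAW]; H. Duminil-Copin, S. Smirnov, Ann. of Math. 175 (2012), Lemma 1 [DuminilCopinSmirnov2012].
-/

noncomputable section

namespace Literature.Barriers.CriticalPhenomena.PlaquetteWalk

open Literature.Probability.RandomPlanarGeometry.SAW.YangBaxter
open Literature.Probability.RandomPlanarGeometry.SAW (hexCriticalFugacity hexCriticalFugacity_pos_lt_one)
open Real Complex

/-- `π/3` lies in the printed range. [folklore] -/
private theorem pi_div_three_mem_Icc_K : (π / 3 : ℝ) ∈ Set.Icc (π / 3) (2 * π / 3) :=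
  ⟨le_rfl, by linarith [Real.pi_pos]⟩

/-- `2π/3` lies in the printed range. [folklore] -/
private theorem two_pi_div_three_mem_Icc_K : (2 * π / 3 : ℝ) ∈ Set.Icc (π / 3) (2 * π / 3) :=
  ⟨by linarith [Real.pi_pos], le_rfl⟩

/-- `v(θ) > 0` on the printed range (it lies inside `(0, π)`). [cite: Glazman2015WeightedSAW, Lemma 3.1, eq. (1) (the weights)] -/
private theorem weightV_pos_of_mem_Icc_K {θ : ℝ} (hθ : θ ∈ Set.Icc (π / 3) (2 * π / 3)) : 0 < weightV θ :=
  weightV_pos_of_mem_Ioo ⟨by linarith [hθ.1, Real.pi_pos], by linarith [hθ.2, Real.pi_pos]⟩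

/-! ## §1 Signs of the far-cell defect at the hexagonal angle `θ = π/3` from honeycomb kills -/

section HoneycombPoint

/-- **`Im VF(π/3) = x_c² · (M_N − M_S)`** at the far cell of a hole root (the far-cell law at the honeycomb point,
coordinate form: `v(π/3) = x_c²`). [cite: GlazmanManolescu2019, Lemma 2.1 (statement, "in the form given in [Gl]")]
[cite: GlazmanManolescu2019, §1 (the paragraph of Fig. 2)] -/
theorem im_vertexFunctional_printed_farCellW_pi_div_three_eq (Dl : List Face) (w : Face) (hf : farW w ∈ Dl)
    (hh : holeFaceW w ∉ dom Dl) (hr : RootedFace (dom Dl) (w.side .W) (farW w)) :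
    (vertexFunctional (printedWeights (π / 3)) tFiveEighths (ybCoeff (π / 3)) Dl (w.side .W) (farW w)).im =
      hexCriticalFugacity ^ 2 *
        ((∑ ω ∈ ΩG.setB2a (dom Dl) (w.side .W) (farW w), ΩG.routeMassW (π / 3) hr .N ω) -
          ∑ ω ∈ ΩG.setB2a (dom Dl) (w.side .W) (farW w), ΩG.routeMassW (π / 3) hr .S ω) := by
  rw [vertexFunctional_printed_farCellW_im_eq pi_div_three_mem_Icc_K Dl w hf hh hr, weightV_pi_div_three]

/-- ★ **UNDER-ROUTE `w₂`-KILL ⇒ `Im VF(π/3) > 0`.** If every wound class-`B2a` walk at the far cell that entered it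
under the hole (first side `S`) passes some other rhombus twice through its two `(π − θ)`-corners, while some wound walk
that entered over the hole (first side `N`) does not, then at `θ = π/3` the imaginary part of the far-cell defect is
STRICTLY POSITIVE (`= x_c²·M_N`, `M_S = 0`). [cite: GlazmanManolescu2019, Lemma 2.1 (statement, "in the form given in [Gl]")]
[cite: GlazmanManolescu2019, §1 (the paragraph of Fig. 2: «if θ = π/3, then w₂ = 0»)] -/
theorem im_vertexFunctional_printed_farCellW_pi_div_three_pos_of_under_killed (Dl : List Face) (w : Face)
    (hf : farW w ∈ Dl) (hh : holeFaceW w ∉ dom Dl) (hr : RootedFace (dom Dl) (w.side .W) (farW w))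
    (hS : ∀ (ω : ΩG (dom Dl) (w.side .W) (farW w)) (h : ω.IsB2a), ω.2.firstSideG = .S →
      ω.WE (fun _ => π / 3) ≠ excursionWinding (π / 3) ω.2.firstSideG (ω.z1 hr h) ω.1 → ¬ω.2.W2FreeOff (farW w))
    (hN : ∃ (ω : ΩG (dom Dl) (w.side .W) (farW w)) (h : ω.IsB2a), ω.2.firstSideG = .N ∧
      ω.WE (fun _ => π / 3) ≠ excursionWinding (π / 3) ω.2.firstSideG (ω.z1 hr h) ω.1 ∧ ω.2.W2FreeOff (farW w)) :
    0 < (vertexFunctional (printedWeights (π / 3)) tFiveEighths (ybCoeff (π / 3)) Dl (w.side .W) (farW w)).im := by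
  rw [im_vertexFunctional_printed_farCellW_pi_div_three_eq Dl w hf hh hr,
    ΩG.sum_routeMassW_pi_div_three_eq_zero_of_killed hr .S hS, sub_zero]
  exact mul_pos (pow_pos hexCriticalFugacity_pos_lt_one.1 2) (ΩG.sum_routeMassW_pi_div_three_pos_of_free hr .N hN)

/-- ★ **OVER-ROUTE `w₂`-KILL ⇒ `Im VF(π/3) < 0`.** The configuration with the routes exchanged: every wound over-walk
`w₂`-marked, some wound under-walk `w₂`-free ⇒ `Im VF(π/3) = −x_c²·M_S < 0`.
[cite: GlazmanManolescu2019, Lemma 2.1 (statement, "in the form given in [Gl]")]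
[cite: GlazmanManolescu2019, §1 (the paragraph of Fig. 2: «if θ = π/3, then w₂ = 0»)] -/
theorem im_vertexFunctional_printed_farCellW_pi_div_three_neg_of_over_killed (Dl : List Face) (w : Face)
    (hf : farW w ∈ Dl) (hh : holeFaceW w ∉ dom Dl) (hr : RootedFace (dom Dl) (w.side .W) (farW w))
    (hN : ∀ (ω : ΩG (dom Dl) (w.side .W) (farW w)) (h : ω.IsB2a), ω.2.firstSideG = .N →
      ω.WE (fun _ => π / 3) ≠ excursionWinding (π / 3) ω.2.firstSideG (ω.z1 hr h) ω.1 → ¬ω.2.W2FreeOff (farW w))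
    (hS : ∃ (ω : ΩG (dom Dl) (w.side .W) (farW w)) (h : ω.IsB2a), ω.2.firstSideG = .S ∧
      ω.WE (fun _ => π / 3) ≠ excursionWinding (π / 3) ω.2.firstSideG (ω.z1 hr h) ω.1 ∧ ω.2.W2FreeOff (farW w)) :
    (vertexFunctional (printedWeights (π / 3)) tFiveEighths (ybCoeff (π / 3)) Dl (w.side .W) (farW w)).im < 0 := by
  rw [im_vertexFunctional_printed_farCellW_pi_div_three_eq Dl w hf hh hr,
    ΩG.sum_routeMassW_pi_div_three_eq_zero_of_killed hr .N hN, zero_sub, mul_neg, neg_lt_zero]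
  exact mul_pos (pow_pos hexCriticalFugacity_pos_lt_one.1 2) (ΩG.sum_routeMassW_pi_div_three_pos_of_free hr .S hS)

end HoneycombPoint

/-! ## §2 Signs at the dual hexagonal angle `θ = 2π/3` from `w₁`-kills -/

section DualPoint

/-- ★ **UNDER-ROUTE `w₁`-KILL ⇒ `Im VF(2π/3) > 0`.** Every wound under-walk at the far cell passes some other rhombus
twice through its two `θ`-corners, some wound over-walk does not ⇒ at `θ = 2π/3` (`w₁ = 0`) `Im VF = v·M_N > 0`.
[cite: GlazmanManolescu2019, Lemma 2.1 (statement, "in the form given in [Gl]")] [cite: GlazmanManolescu2019, §1, remark after eq. (1)] -/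
theorem im_vertexFunctional_printed_farCellW_two_pi_div_three_pos_of_under_killed (Dl : List Face) (w : Face)
    (hf : farW w ∈ Dl) (hh : holeFaceW w ∉ dom Dl) (hr : RootedFace (dom Dl) (w.side .W) (farW w))
    (hS : ∀ (ω : ΩG (dom Dl) (w.side .W) (farW w)) (h : ω.IsB2a), ω.2.firstSideG = .S →
      ω.WE (fun _ => 2 * π / 3) ≠ excursionWinding (2 * π / 3) ω.2.firstSideG (ω.z1 hr h) ω.1 →
        ¬ω.2.W1FreeOff (farW w))
    (hN : ∃ (ω : ΩG (dom Dl) (w.side .W) (farW w)) (h : ω.IsB2a), ω.2.firstSideG = .N ∧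
      ω.WE (fun _ => 2 * π / 3) ≠ excursionWinding (2 * π / 3) ω.2.firstSideG (ω.z1 hr h) ω.1 ∧
        ω.2.W1FreeOff (farW w)) :
    0 < (vertexFunctional (printedWeights (2 * π / 3)) tFiveEighths (ybCoeff (2 * π / 3)) Dl (w.side .W)
      (farW w)).im := by
  rw [vertexFunctional_printed_farCellW_im_eq two_pi_div_three_mem_Icc_K Dl w hf hh hr,
    ΩG.sum_routeMassW_two_pi_div_three_eq_zero_of_killed hr .S hS, sub_zero]
  exact mul_pos (weightV_pos_of_mem_Icc_K two_pi_div_three_mem_Icc_K)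
    (ΩG.sum_routeMassW_two_pi_div_three_pos_of_free hr .N hN)

/-- ★ **OVER-ROUTE `w₁`-KILL ⇒ `Im VF(2π/3) < 0`.** Every wound over-walk `w₁`-marked, some wound under-walk `w₁`-free ⇒
at `θ = 2π/3` `Im VF = −v·M_S < 0`. [cite: GlazmanManolescu2019, Lemma 2.1 (statement, "in the form given in [Gl]")]
[cite: GlazmanManolescu2019, §1, remark after eq. (1)] -/
theorem im_vertexFunctional_printed_farCellW_two_pi_div_three_neg_of_over_killed (Dl : List Face) (w : Face)
    (hf : farW w ∈ Dl) (hh : holeFaceW w ∉ dom Dl) (hr : RootedFace (dom Dl) (w.side .W) (farW w))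
    (hN : ∀ (ω : ΩG (dom Dl) (w.side .W) (farW w)) (h : ω.IsB2a), ω.2.firstSideG = .N →
      ω.WE (fun _ => 2 * π / 3) ≠ excursionWinding (2 * π / 3) ω.2.firstSideG (ω.z1 hr h) ω.1 →
        ¬ω.2.W1FreeOff (farW w))
    (hS : ∃ (ω : ΩG (dom Dl) (w.side .W) (farW w)) (h : ω.IsB2a), ω.2.firstSideG = .S ∧
      ω.WE (fun _ => 2 * π / 3) ≠ excursionWinding (2 * π / 3) ω.2.firstSideG (ω.z1 hr h) ω.1 ∧
        ω.2.W1FreeOff (farW w)) :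
    (vertexFunctional (printedWeights (2 * π / 3)) tFiveEighths (ybCoeff (2 * π / 3)) Dl (w.side .W)
      (farW w)).im < 0 := by
  rw [vertexFunctional_printed_farCellW_im_eq two_pi_div_three_mem_Icc_K Dl w hf hh hr,
    ΩG.sum_routeMassW_two_pi_div_three_eq_zero_of_killed hr .N hN, zero_sub, mul_neg, neg_lt_zero]
  exact mul_pos (weightV_pos_of_mem_Icc_K two_pi_div_three_mem_Icc_K)
    (ΩG.sum_routeMassW_two_pi_div_three_pos_of_free hr .S hS)

end DualPoint

/-! ## §3 Strict opposite signs of `Im VF` at two printed angles ⇒ a zero in the open interval -/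

section StrictSigns

/-- **Strict signs, increasing order**: `Im VF(θ₁) > 0 > Im VF(θ₂)` at two printed angles `θ₁ ≤ θ₂` ⇒ the far-cell
defect vanishes EXACTLY at some `θ ∈ (θ₁, θ₂)`. [cite: GlazmanManolescu2019, Lemma 2.1 (statement, "in the form given in [Gl]")]
[cite: Glazman2015WeightedSAW, Lemma 3.1 (proof, pp. 6–7)] [cite: DuminilCopinSmirnov2012, proof of Lemma 1] -/
theorem vertexFunctional_printed_farCellW_exists_eq_zero_Ioo_of_im_pos_of_im_neg {θ₁ θ₂ : ℝ} (h12 : θ₁ ≤ θ₂)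
    (hθ₁ : θ₁ ∈ Set.Icc (π / 3) (2 * π / 3)) (hθ₂ : θ₂ ∈ Set.Icc (π / 3) (2 * π / 3))
    (Dl : List Face) (w : Face) (hf : farW w ∈ Dl) (hh : holeFaceW w ∉ dom Dl)
    (h₁ : 0 < (vertexFunctional (printedWeights θ₁) tFiveEighths (ybCoeff θ₁) Dl (w.side .W) (farW w)).im)
    (h₂ : (vertexFunctional (printedWeights θ₂) tFiveEighths (ybCoeff θ₂) Dl (w.side .W) (farW w)).im < 0) :
    ∃ θ ∈ Set.Ioo θ₁ θ₂,
      vertexFunctional (printedWeights θ) tFiveEighths (ybCoeff θ) Dl (w.side .W) (farW w) = 0 :=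
  vertexFunctional_printed_farCellW_exists_eq_zero_Ioo h12 hθ₁ hθ₂ Dl w hf hh
    (mul_nonpos_of_nonneg_of_nonpos h₁.le h₂.le)
    (fun e => by rw [e, Complex.zero_im] at h₁; exact lt_irrefl _ h₁)
    (fun e => by rw [e, Complex.zero_im] at h₂; exact lt_irrefl _ h₂)

/-- **Strict signs, decreasing order**: `Im VF(θ₁) < 0 < Im VF(θ₂)` ⇒ an exact zero in `(θ₁, θ₂)`.
[cite: GlazmanManolescu2019, Lemma 2.1 (statement, "in the form given in [Gl]")] [cite: Glazman2015WeightedSAW, Lemma 3.1 (proof, pp. 6–7)]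
[cite: DuminilCopinSmirnov2012, proof of Lemma 1] -/
theorem vertexFunctional_printed_farCellW_exists_eq_zero_Ioo_of_im_neg_of_im_pos {θ₁ θ₂ : ℝ} (h12 : θ₁ ≤ θ₂)
    (hθ₁ : θ₁ ∈ Set.Icc (π / 3) (2 * π / 3)) (hθ₂ : θ₂ ∈ Set.Icc (π / 3) (2 * π / 3))
    (Dl : List Face) (w : Face) (hf : farW w ∈ Dl) (hh : holeFaceW w ∉ dom Dl)
    (h₁ : (vertexFunctional (printedWeights θ₁) tFiveEighths (ybCoeff θ₁) Dl (w.side .W) (farW w)).im < 0)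
    (h₂ : 0 < (vertexFunctional (printedWeights θ₂) tFiveEighths (ybCoeff θ₂) Dl (w.side .W) (farW w)).im) :
    ∃ θ ∈ Set.Ioo θ₁ θ₂,
      vertexFunctional (printedWeights θ) tFiveEighths (ybCoeff θ) Dl (w.side .W) (farW w) = 0 :=
  vertexFunctional_printed_farCellW_exists_eq_zero_Ioo h12 hθ₁ hθ₂ Dl w hf hh
    (mul_nonpos_of_nonpos_of_nonneg h₁.le h₂.le)
    (fun e => by rw [e, Complex.zero_im] at h₁; exact lt_irrefl _ h₁)
    (fun e => by rw [e, Complex.zero_im] at h₂; exact lt_irrefl _ h₂)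

end StrictSigns

/-! ## §4 KILL-FORCED ZEROS -/

section KillForced

/-- ★★★ **KILL-FORCED CONTINUITY ZEROS.** At the far cell of a hole root (`W`-normalisation), suppose
(honeycomb point `θ = π/3`) EVERY wound class-`B2a` walk that entered under the hole passes some other rhombus twice
through its two `(π − θ)`-corners while SOME wound walk that entered over the hole does not, and (dual point
`θ = 2π/3`) EVERY wound walk that entered over the hole passes some other rhombus twice through its two `θ`-corners while
SOME wound walk that entered under the hole does not. Then the Yang–Baxter vertex functional of the hole root vanishes
EXACTLY at some angle `θ* ∈ (π/3, 2π/3)`: `Im VF(π/3) = x_c²·M_N(π/3) > 0`, `Im VF(2π/3) = −v·M_S(2π/3) < 0`, `Re VF ≡ 0`,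
and the functional is continuous in the angle. No mass is evaluated and no symmetry of the domain is used.
[cite: GlazmanManolescu2019, Lemma 2.1 (statement, "in the form given in [Gl]")] [cite: GlazmanManolescu2019, §1 (the paragraph of Fig. 2 and the remark after eq. (1))]
[cite: Glazman2015WeightedSAW, Lemma 3.1 (proof, pp. 6–7)] [cite: DuminilCopinSmirnov2012, proof of Lemma 1] -/
theorem vertexFunctional_printed_farCellW_exists_eq_zero_Ioo_of_opposite_kills (Dl : List Face) (w : Face)
    (hf : farW w ∈ Dl) (hh : holeFaceW w ∉ dom Dl) (hr : RootedFace (dom Dl) (w.side .W) (farW w))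
    (hS₂ : ∀ (ω : ΩG (dom Dl) (w.side .W) (farW w)) (h : ω.IsB2a), ω.2.firstSideG = .S →
      ω.WE (fun _ => π / 3) ≠ excursionWinding (π / 3) ω.2.firstSideG (ω.z1 hr h) ω.1 → ¬ω.2.W2FreeOff (farW w))
    (hN₂ : ∃ (ω : ΩG (dom Dl) (w.side .W) (farW w)) (h : ω.IsB2a), ω.2.firstSideG = .N ∧
      ω.WE (fun _ => π / 3) ≠ excursionWinding (π / 3) ω.2.firstSideG (ω.z1 hr h) ω.1 ∧ ω.2.W2FreeOff (farW w))
    (hN₁ : ∀ (ω : ΩG (dom Dl) (w.side .W) (farW w)) (h : ω.IsB2a), ω.2.firstSideG = .N →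
      ω.WE (fun _ => 2 * π / 3) ≠ excursionWinding (2 * π / 3) ω.2.firstSideG (ω.z1 hr h) ω.1 →
        ¬ω.2.W1FreeOff (farW w))
    (hS₁ : ∃ (ω : ΩG (dom Dl) (w.side .W) (farW w)) (h : ω.IsB2a), ω.2.firstSideG = .S ∧
      ω.WE (fun _ => 2 * π / 3) ≠ excursionWinding (2 * π / 3) ω.2.firstSideG (ω.z1 hr h) ω.1 ∧
        ω.2.W1FreeOff (farW w)) :
    ∃ θ ∈ Set.Ioo (π / 3) (2 * π / 3),
      vertexFunctional (printedWeights θ) tFiveEighths (ybCoeff θ) Dl (w.side .W) (farW w) = 0 :=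
  vertexFunctional_printed_farCellW_exists_eq_zero_Ioo_of_im_pos_of_im_neg (by linarith [Real.pi_pos])
    pi_div_three_mem_Icc_K two_pi_div_three_mem_Icc_K Dl w hf hh
    (im_vertexFunctional_printed_farCellW_pi_div_three_pos_of_under_killed Dl w hf hh hr hS₂ hN₂)
    (im_vertexFunctional_printed_farCellW_two_pi_div_three_neg_of_over_killed Dl w hf hh hr hN₁ hS₁)

/-- ★★★ **KILL-FORCED CONTINUITY ZEROS, routes exchanged.** Every wound over-walk `w₂`-marked and some wound under-walk
`w₂`-free (so `Im VF(π/3) < 0`), every wound under-walk `w₁`-marked and some wound over-walk `w₁`-free (so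
`Im VF(2π/3) > 0`) ⇒ an exact zero of the far-cell defect at some `θ* ∈ (π/3, 2π/3)`.
[cite: GlazmanManolescu2019, Lemma 2.1 (statement, "in the form given in [Gl]")] [cite: GlazmanManolescu2019, §1 (the paragraph of Fig. 2 and the remark after eq. (1))]
[cite: Glazman2015WeightedSAW, Lemma 3.1 (proof, pp. 6–7)] [cite: DuminilCopinSmirnov2012, proof of Lemma 1] -/
theorem vertexFunctional_printed_farCellW_exists_eq_zero_Ioo_of_opposite_kills' (Dl : List Face) (w : Face)
    (hf : farW w ∈ Dl) (hh : holeFaceW w ∉ dom Dl) (hr : RootedFace (dom Dl) (w.side .W) (farW w))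
    (hN₂ : ∀ (ω : ΩG (dom Dl) (w.side .W) (farW w)) (h : ω.IsB2a), ω.2.firstSideG = .N →
      ω.WE (fun _ => π / 3) ≠ excursionWinding (π / 3) ω.2.firstSideG (ω.z1 hr h) ω.1 → ¬ω.2.W2FreeOff (farW w))
    (hS₂ : ∃ (ω : ΩG (dom Dl) (w.side .W) (farW w)) (h : ω.IsB2a), ω.2.firstSideG = .S ∧
      ω.WE (fun _ => π / 3) ≠ excursionWinding (π / 3) ω.2.firstSideG (ω.z1 hr h) ω.1 ∧ ω.2.W2FreeOff (farW w))
    (hS₁ : ∀ (ω : ΩG (dom Dl) (w.side .W) (farW w)) (h : ω.IsB2a), ω.2.firstSideG = .S →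
      ω.WE (fun _ => 2 * π / 3) ≠ excursionWinding (2 * π / 3) ω.2.firstSideG (ω.z1 hr h) ω.1 →
        ¬ω.2.W1FreeOff (farW w))
    (hN₁ : ∃ (ω : ΩG (dom Dl) (w.side .W) (farW w)) (h : ω.IsB2a), ω.2.firstSideG = .N ∧
      ω.WE (fun _ => 2 * π / 3) ≠ excursionWinding (2 * π / 3) ω.2.firstSideG (ω.z1 hr h) ω.1 ∧
        ω.2.W1FreeOff (farW w)) :
    ∃ θ ∈ Set.Ioo (π / 3) (2 * π / 3),
      vertexFunctional (printedWeights θ) tFiveEighths (ybCoeff θ) Dl (w.side .W) (farW w) = 0 :=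
  vertexFunctional_printed_farCellW_exists_eq_zero_Ioo_of_im_neg_of_im_pos (by linarith [Real.pi_pos])
    pi_div_three_mem_Icc_K two_pi_div_three_mem_Icc_K Dl w hf hh
    (im_vertexFunctional_printed_farCellW_pi_div_three_neg_of_over_killed Dl w hf hh hr hN₂ hS₂)
    (im_vertexFunctional_printed_farCellW_two_pi_div_three_pos_of_under_killed Dl w hf hh hr hS₁ hN₁)

/-- ★★ **ONE KILL AND ONE SIGN (upper kill).** A `w₁`-kill of the over route at the dual point with a `w₁`-free
wound under-walk (`Im VF(2π/3) < 0`) and a printed angle `θ₁` with `Im VF(θ₁) > 0` ⇒ an exact zero in `(θ₁, 2π/3)` —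
the mechanism of the lane's first off-mirror zero (`5×5 ∖ {(2,2),(0,4)}`, `θ* ≈ 0.44·π`: there the sign at `θ₁ = π/3`
is a mass comparison, the sign at `2π/3` is this kill). [cite: GlazmanManolescu2019, Lemma 2.1 (statement, "in the form given in [Gl]")]
[cite: GlazmanManolescu2019, §1, remark after eq. (1)] [cite: DuminilCopinSmirnov2012, proof of Lemma 1] -/
theorem vertexFunctional_printed_farCellW_exists_eq_zero_Ioo_of_im_pos_of_over_killed {θ₁ : ℝ}
    (hθ₁ : θ₁ ∈ Set.Icc (π / 3) (2 * π / 3)) (Dl : List Face) (w : Face)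
    (hf : farW w ∈ Dl) (hh : holeFaceW w ∉ dom Dl) (hr : RootedFace (dom Dl) (w.side .W) (farW w))
    (h₁ : 0 < (vertexFunctional (printedWeights θ₁) tFiveEighths (ybCoeff θ₁) Dl (w.side .W) (farW w)).im)
    (hN₁ : ∀ (ω : ΩG (dom Dl) (w.side .W) (farW w)) (h : ω.IsB2a), ω.2.firstSideG = .N →
      ω.WE (fun _ => 2 * π / 3) ≠ excursionWinding (2 * π / 3) ω.2.firstSideG (ω.z1 hr h) ω.1 →
        ¬ω.2.W1FreeOff (farW w))
    (hS₁ : ∃ (ω : ΩG (dom Dl) (w.side .W) (farW w)) (h : ω.IsB2a), ω.2.firstSideG = .S ∧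
      ω.WE (fun _ => 2 * π / 3) ≠ excursionWinding (2 * π / 3) ω.2.firstSideG (ω.z1 hr h) ω.1 ∧
        ω.2.W1FreeOff (farW w)) :
    ∃ θ ∈ Set.Ioo θ₁ (2 * π / 3),
      vertexFunctional (printedWeights θ) tFiveEighths (ybCoeff θ) Dl (w.side .W) (farW w) = 0 :=
  vertexFunctional_printed_farCellW_exists_eq_zero_Ioo_of_im_pos_of_im_neg hθ₁.2 hθ₁ two_pi_div_three_mem_Icc_K
    Dl w hf hh h₁ (im_vertexFunctional_printed_farCellW_two_pi_div_three_neg_of_over_killed Dl w hf hh hr hN₁ hS₁)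

/-- ★★ **ONE KILL AND ONE SIGN (lower kill).** A `w₂`-kill of the under route at the honeycomb point with a
`w₂`-free wound over-walk (`Im VF(π/3) > 0`) and a printed angle `θ₂` with `Im VF(θ₂) < 0` ⇒ an exact zero in
`(π/3, θ₂)`. [cite: GlazmanManolescu2019, Lemma 2.1 (statement, "in the form given in [Gl]")]
[cite: GlazmanManolescu2019, §1 (the paragraph of Fig. 2)] [cite: DuminilCopinSmirnov2012, proof of Lemma 1] -/
theorem vertexFunctional_printed_farCellW_exists_eq_zero_Ioo_of_under_killed_of_im_neg {θ₂ : ℝ}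
    (hθ₂ : θ₂ ∈ Set.Icc (π / 3) (2 * π / 3)) (Dl : List Face) (w : Face)
    (hf : farW w ∈ Dl) (hh : holeFaceW w ∉ dom Dl) (hr : RootedFace (dom Dl) (w.side .W) (farW w))
    (hS₂ : ∀ (ω : ΩG (dom Dl) (w.side .W) (farW w)) (h : ω.IsB2a), ω.2.firstSideG = .S →
      ω.WE (fun _ => π / 3) ≠ excursionWinding (π / 3) ω.2.firstSideG (ω.z1 hr h) ω.1 → ¬ω.2.W2FreeOff (farW w))
    (hN₂ : ∃ (ω : ΩG (dom Dl) (w.side .W) (farW w)) (h : ω.IsB2a), ω.2.firstSideG = .N ∧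
      ω.WE (fun _ => π / 3) ≠ excursionWinding (π / 3) ω.2.firstSideG (ω.z1 hr h) ω.1 ∧ ω.2.W2FreeOff (farW w))
    (h₂ : (vertexFunctional (printedWeights θ₂) tFiveEighths (ybCoeff θ₂) Dl (w.side .W) (farW w)).im < 0) :
    ∃ θ ∈ Set.Ioo (π / 3) θ₂,
      vertexFunctional (printedWeights θ) tFiveEighths (ybCoeff θ) Dl (w.side .W) (farW w) = 0 :=
  vertexFunctional_printed_farCellW_exists_eq_zero_Ioo_of_im_pos_of_im_neg hθ₂.1 pi_div_three_mem_Icc_K hθ₂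
    Dl w hf hh (im_vertexFunctional_printed_farCellW_pi_div_three_pos_of_under_killed Dl w hf hh hr hS₂ hN₂) h₂

end KillForced

/-! ## §5 At a kill-forced zero the two route masses balance -/

section Balance

/-- **At the zero the routes BALANCE.** Under the hypotheses of the kill-forced zero there is an angle
`θ* ∈ (π/3, 2π/3)` at which the two route masses of the wound class-`B2a` walks at the far cell are EQUAL
(`M_N(θ*) = M_S(θ*)`) — although at `π/3` only the over route and at `2π/3` only the under route carries honeycomb mass.
[cite: GlazmanManolescu2019, Lemma 2.1 (statement, "in the form given in [Gl]")] [cite: Glazman2015WeightedSAW, Lemma 3.1, eq. (1) (the weight v(θ))] -/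
theorem routeMassW_sum_eq_at_kill_forced_zero (Dl : List Face) (w : Face)
    (hf : farW w ∈ Dl) (hh : holeFaceW w ∉ dom Dl) (hr : RootedFace (dom Dl) (w.side .W) (farW w))
    (hS₂ : ∀ (ω : ΩG (dom Dl) (w.side .W) (farW w)) (h : ω.IsB2a), ω.2.firstSideG = .S →
      ω.WE (fun _ => π / 3) ≠ excursionWinding (π / 3) ω.2.firstSideG (ω.z1 hr h) ω.1 → ¬ω.2.W2FreeOff (farW w))
    (hN₂ : ∃ (ω : ΩG (dom Dl) (w.side .W) (farW w)) (h : ω.IsB2a), ω.2.firstSideG = .N ∧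
      ω.WE (fun _ => π / 3) ≠ excursionWinding (π / 3) ω.2.firstSideG (ω.z1 hr h) ω.1 ∧ ω.2.W2FreeOff (farW w))
    (hN₁ : ∀ (ω : ΩG (dom Dl) (w.side .W) (farW w)) (h : ω.IsB2a), ω.2.firstSideG = .N →
      ω.WE (fun _ => 2 * π / 3) ≠ excursionWinding (2 * π / 3) ω.2.firstSideG (ω.z1 hr h) ω.1 →
        ¬ω.2.W1FreeOff (farW w))
    (hS₁ : ∃ (ω : ΩG (dom Dl) (w.side .W) (farW w)) (h : ω.IsB2a), ω.2.firstSideG = .S ∧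
      ω.WE (fun _ => 2 * π / 3) ≠ excursionWinding (2 * π / 3) ω.2.firstSideG (ω.z1 hr h) ω.1 ∧
        ω.2.W1FreeOff (farW w)) :
    ∃ θ ∈ Set.Ioo (π / 3) (2 * π / 3),
      ∑ ω ∈ ΩG.setB2a (dom Dl) (w.side .W) (farW w), ΩG.routeMassW θ hr .N ω =
        ∑ ω ∈ ΩG.setB2a (dom Dl) (w.side .W) (farW w), ΩG.routeMassW θ hr .S ω := by
  obtain ⟨θ, hθ, hz⟩ :=
    vertexFunctional_printed_farCellW_exists_eq_zero_Ioo_of_opposite_kills Dl w hf hh hr hS₂ hN₂ hN₁ hS₁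
  exact ⟨θ, hθ, (vertexFunctional_printed_farCellW_eq_zero_iff (Set.Ioo_subset_Icc_self hθ) Dl w hf hh hr).1 hz⟩

end Balance

end Literature.Barriers.CriticalPhenomena.PlaquetteWalk

/-! ## §6 (edition 2) KILL-FORCED ZEROS AT THE LATERAL CELL ABOVE THE HOLE

The lateral cell `latN w = (w.1 − 1, w.2 + 1)` of the hole root `w.side W`: by the LATERAL-CELL LAW
(`PlaquetteWalkHoleRootLateralCellLaw`) the defect is `i·v(θ)·e^{i(3θ/8 + 5π/8)}·(M_W − M_E)`, `M_W, M_E` the route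
masses of the wound class-`B2a` walks that first entered the lateral cell from `W` (under and around the hole) resp. from
`E` (directly, over the root plaquette); it vanishes iff `M_W = M_E` (`vertexFunctional_printed_latN_eq_zero_iff`), and a
weak sign change of `M_W − M_E` between two printed angles forces an exact zero
(`PlaquetteWalkHoleRootContinuityZeros` §C). The honeycomb editions of the lateral law supply the `π/3` kills
(`ΩG.sum_routeMassL_pi_div_three_eq_zero_of_killed` / `…_pos_of_free`); the dual-point twins are proved here. -/

namespace Literature.Probability.RandomPlanarGeometry.SAW.YangBaxter

open Real

namespace ΩG

variable {D : Set Face} {w : Face}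

/-- A route at the lateral cell all of whose wound walks are `w₁`-marked (some rhombus off the lateral cell carries two
`θ`-corner arcs) has route mass ZERO at `θ = 2π/3`. [cite: GlazmanManolescu2019, §1, remark after eq. (1)] -/
theorem sum_routeMassL_two_pi_div_three_eq_zero_of_killed [Finite D] (hr : RootedFace D (w.side .W) (latN w))
    (s : Side)
    (hK : ∀ (ω : ΩG D (w.side .W) (latN w)) (h : ω.IsB2a), ω.2.firstSideG = s →
      ω.WE (fun _ => 2 * π / 3) ≠ excursionWinding (2 * π / 3) ω.2.firstSideG (ω.z1 hr h) ω.1 →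
        ¬ω.2.W1FreeOff (latN w)) :
    ∑ ω ∈ setB2a D (w.side .W) (latN w), routeMassL (2 * π / 3) hr s ω = 0 := by
  classical
  refine Finset.sum_eq_zero fun ω _ => ?_
  unfold routeMassL
  split_ifs with h1 h2
  · exact ω.2.extWeight_two_pi_div_three_eq_zero _ (hK ω h1 h2.1 h2.2)
  · rfl
  · rfl

/-- A route at the lateral cell with a `w₁`-free wound walk has POSITIVE route mass at `θ = 2π/3`.
[cite: GlazmanManolescu2019, §1, remark after eq. (1)] [cite: Glazman2015WeightedSAW, Lemma 3.1, eq. (1) (the weights)] -/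
theorem sum_routeMassL_two_pi_div_three_pos_of_free [Finite D] (hr : RootedFace D (w.side .W) (latN w)) (s : Side)
    (hF : ∃ (ω : ΩG D (w.side .W) (latN w)) (h : ω.IsB2a), ω.2.firstSideG = s ∧
      ω.WE (fun _ => 2 * π / 3) ≠ excursionWinding (2 * π / 3) ω.2.firstSideG (ω.z1 hr h) ω.1 ∧
        ω.2.W1FreeOff (latN w)) :
    0 < ∑ ω ∈ setB2a D (w.side .W) (latN w), routeMassL (2 * π / 3) hr s ω := by
  classical
  have hθ : (2 * π / 3 : ℝ) ∈ Set.Icc (π / 3) (2 * π / 3) := ⟨by linarith [Real.pi_pos], le_rfl⟩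
  obtain ⟨ω₀, h₀, hz₀, hW₀, hF₀⟩ := hF
  have hmem : ω₀ ∈ setB2a D (w.side .W) (latN w) := by
    simp only [setB2a, Finset.mem_filter, Finset.mem_univ, true_and]; exact h₀
  refine lt_of_lt_of_le ?_ (Finset.single_le_sum (fun ω _ => routeMassL_nonneg hθ hr s ω) hmem)
  unfold routeMassL
  rw [dif_pos h₀, if_pos ⟨hz₀, hW₀⟩]
  exact ω₀.2.extWeight_two_pi_div_three_pos _ hF₀

end ΩG

end Literature.Probability.RandomPlanarGeometry.SAW.YangBaxter

namespace Literature.Barriers.CriticalPhenomena.PlaquetteWalk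

open Literature.Probability.RandomPlanarGeometry.SAW.YangBaxter
open Real Complex

section LateralCell

/-- ★ **EAST-ROUTE `w₂`-KILL AT THE LATERAL CELL ⇒ `M_W − M_E > 0` at `θ = π/3`.** Every wound walk that entered the
lateral cell from `E` is `w₂`-marked, some wound walk that entered from `W` is `w₂`-free.
[cite: GlazmanManolescu2019, Lemma 2.1 (statement, "in the form given in [Gl]")] [cite: GlazmanManolescu2019, §1 (the paragraph of Fig. 2)] -/
theorem routeMassL_diff_pi_div_three_pos_of_east_killed (Dl : List Face) (w : Face)
    (hr : RootedFace (dom Dl) (w.side .W) (latN w))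
    (hE : ∀ (ω : ΩG (dom Dl) (w.side .W) (latN w)) (h : ω.IsB2a), ω.2.firstSideG = .E →
      ω.WE (fun _ => π / 3) ≠ excursionWinding (π / 3) ω.2.firstSideG (ω.z1 hr h) ω.1 → ¬ω.2.W2FreeOff (latN w))
    (hW : ∃ (ω : ΩG (dom Dl) (w.side .W) (latN w)) (h : ω.IsB2a), ω.2.firstSideG = .W ∧
      ω.WE (fun _ => π / 3) ≠ excursionWinding (π / 3) ω.2.firstSideG (ω.z1 hr h) ω.1 ∧ ω.2.W2FreeOff (latN w)) :
    0 < (∑ ω ∈ ΩG.setB2a (dom Dl) (w.side .W) (latN w), ΩG.routeMassL (π / 3) hr .W ω) -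
      ∑ ω ∈ ΩG.setB2a (dom Dl) (w.side .W) (latN w), ΩG.routeMassL (π / 3) hr .E ω := by
  rw [ΩG.sum_routeMassL_pi_div_three_eq_zero_of_killed hr .E hE, sub_zero]
  exact ΩG.sum_routeMassL_pi_div_three_pos_of_free hr .W hW

/-- ★ **WEST-ROUTE `w₂`-KILL AT THE LATERAL CELL ⇒ `M_W − M_E < 0` at `θ = π/3`.**
[cite: GlazmanManolescu2019, Lemma 2.1 (statement, "in the form given in [Gl]")] [cite: GlazmanManolescu2019, §1 (the paragraph of Fig. 2)] -/
theorem routeMassL_diff_pi_div_three_neg_of_west_killed (Dl : List Face) (w : Face)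
    (hr : RootedFace (dom Dl) (w.side .W) (latN w))
    (hW : ∀ (ω : ΩG (dom Dl) (w.side .W) (latN w)) (h : ω.IsB2a), ω.2.firstSideG = .W →
      ω.WE (fun _ => π / 3) ≠ excursionWinding (π / 3) ω.2.firstSideG (ω.z1 hr h) ω.1 → ¬ω.2.W2FreeOff (latN w))
    (hE : ∃ (ω : ΩG (dom Dl) (w.side .W) (latN w)) (h : ω.IsB2a), ω.2.firstSideG = .E ∧
      ω.WE (fun _ => π / 3) ≠ excursionWinding (π / 3) ω.2.firstSideG (ω.z1 hr h) ω.1 ∧ ω.2.W2FreeOff (latN w)) :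
    (∑ ω ∈ ΩG.setB2a (dom Dl) (w.side .W) (latN w), ΩG.routeMassL (π / 3) hr .W ω) -
      ∑ ω ∈ ΩG.setB2a (dom Dl) (w.side .W) (latN w), ΩG.routeMassL (π / 3) hr .E ω < 0 := by
  rw [ΩG.sum_routeMassL_pi_div_three_eq_zero_of_killed hr .W hW, zero_sub, neg_lt_zero]
  exact ΩG.sum_routeMassL_pi_div_three_pos_of_free hr .E hE

/-- ★ **EAST-ROUTE `w₁`-KILL AT THE LATERAL CELL ⇒ `M_W − M_E > 0` at `θ = 2π/3`.**
[cite: GlazmanManolescu2019, Lemma 2.1 (statement, "in the form given in [Gl]")] [cite: GlazmanManolescu2019, §1, remark after eq. (1)] -/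
theorem routeMassL_diff_two_pi_div_three_pos_of_east_killed (Dl : List Face) (w : Face)
    (hr : RootedFace (dom Dl) (w.side .W) (latN w))
    (hE : ∀ (ω : ΩG (dom Dl) (w.side .W) (latN w)) (h : ω.IsB2a), ω.2.firstSideG = .E →
      ω.WE (fun _ => 2 * π / 3) ≠ excursionWinding (2 * π / 3) ω.2.firstSideG (ω.z1 hr h) ω.1 →
        ¬ω.2.W1FreeOff (latN w))
    (hW : ∃ (ω : ΩG (dom Dl) (w.side .W) (latN w)) (h : ω.IsB2a), ω.2.firstSideG = .W ∧
      ω.WE (fun _ => 2 * π / 3) ≠ excursionWinding (2 * π / 3) ω.2.firstSideG (ω.z1 hr h) ω.1 ∧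
        ω.2.W1FreeOff (latN w)) :
    0 < (∑ ω ∈ ΩG.setB2a (dom Dl) (w.side .W) (latN w), ΩG.routeMassL (2 * π / 3) hr .W ω) -
      ∑ ω ∈ ΩG.setB2a (dom Dl) (w.side .W) (latN w), ΩG.routeMassL (2 * π / 3) hr .E ω := by
  rw [ΩG.sum_routeMassL_two_pi_div_three_eq_zero_of_killed hr .E hE, sub_zero]
  exact ΩG.sum_routeMassL_two_pi_div_three_pos_of_free hr .W hW

/-- ★ **WEST-ROUTE `w₁`-KILL AT THE LATERAL CELL ⇒ `M_W − M_E < 0` at `θ = 2π/3`.**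
[cite: GlazmanManolescu2019, Lemma 2.1 (statement, "in the form given in [Gl]")] [cite: GlazmanManolescu2019, §1, remark after eq. (1)] -/
theorem routeMassL_diff_two_pi_div_three_neg_of_west_killed (Dl : List Face) (w : Face)
    (hr : RootedFace (dom Dl) (w.side .W) (latN w))
    (hW : ∀ (ω : ΩG (dom Dl) (w.side .W) (latN w)) (h : ω.IsB2a), ω.2.firstSideG = .W →
      ω.WE (fun _ => 2 * π / 3) ≠ excursionWinding (2 * π / 3) ω.2.firstSideG (ω.z1 hr h) ω.1 →
        ¬ω.2.W1FreeOff (latN w))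
    (hE : ∃ (ω : ΩG (dom Dl) (w.side .W) (latN w)) (h : ω.IsB2a), ω.2.firstSideG = .E ∧
      ω.WE (fun _ => 2 * π / 3) ≠ excursionWinding (2 * π / 3) ω.2.firstSideG (ω.z1 hr h) ω.1 ∧
        ω.2.W1FreeOff (latN w)) :
    (∑ ω ∈ ΩG.setB2a (dom Dl) (w.side .W) (latN w), ΩG.routeMassL (2 * π / 3) hr .W ω) -
      ∑ ω ∈ ΩG.setB2a (dom Dl) (w.side .W) (latN w), ΩG.routeMassL (2 * π / 3) hr .E ω < 0 := by
  rw [ΩG.sum_routeMassL_two_pi_div_three_eq_zero_of_killed hr .W hW, zero_sub, neg_lt_zero]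
  exact ΩG.sum_routeMassL_two_pi_div_three_pos_of_free hr .E hE

/-- `π/3` lies in the printed range. [folklore] -/
private theorem pi_div_three_mem_Icc_KL : (π / 3 : ℝ) ∈ Set.Icc (π / 3) (2 * π / 3) :=
  ⟨le_rfl, by linarith [Real.pi_pos]⟩

/-- `2π/3` lies in the printed range. [folklore] -/
private theorem two_pi_div_three_mem_Icc_KL : (2 * π / 3 : ℝ) ∈ Set.Icc (π / 3) (2 * π / 3) :=
  ⟨by linarith [Real.pi_pos], le_rfl⟩

/-- **Strict opposite signs of `M_W − M_E` at the two hexagonal angles ⇒ a zero of the lateral defect in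
`(π/3, 2π/3)`** (the strict form of the catalogue's lateral continuity zeros, with the end values non-zero by
`…_latN_eq_zero_iff`). [cite: GlazmanManolescu2019, Lemma 2.1 (statement, "in the form given in [Gl]")]
[cite: Glazman2015WeightedSAW, Lemma 3.1 (proof, pp. 6–7)] [cite: DuminilCopinSmirnov2012, proof of Lemma 1] -/
theorem vertexFunctional_printed_latN_exists_eq_zero_Ioo_of_diff_signs (Dl : List Face) (w : Face)
    (hf : latN w ∈ Dl) (hh : holeFaceW w ∉ dom Dl) (hr : RootedFace (dom Dl) (w.side .W) (latN w))
    (h₁ : 0 < (∑ ω ∈ ΩG.setB2a (dom Dl) (w.side .W) (latN w), ΩG.routeMassL (π / 3) hr .W ω) -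
      ∑ ω ∈ ΩG.setB2a (dom Dl) (w.side .W) (latN w), ΩG.routeMassL (π / 3) hr .E ω)
    (h₂ : (∑ ω ∈ ΩG.setB2a (dom Dl) (w.side .W) (latN w), ΩG.routeMassL (2 * π / 3) hr .W ω) -
      ∑ ω ∈ ΩG.setB2a (dom Dl) (w.side .W) (latN w), ΩG.routeMassL (2 * π / 3) hr .E ω < 0) :
    ∃ θ ∈ Set.Ioo (π / 3) (2 * π / 3),
      vertexFunctional (printedWeights θ) tFiveEighths (ybCoeff θ) Dl (w.side .W) (latN w) = 0 := by
  refine vertexFunctional_printed_latN_exists_eq_zero_Ioo (by linarith [Real.pi_pos]) pi_div_three_mem_Icc_KL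
    two_pi_div_three_mem_Icc_KL Dl w hf hh hr (mul_nonpos_of_nonneg_of_nonpos h₁.le h₂.le) ?_ ?_
  · rw [Ne, vertexFunctional_printed_latN_eq_zero_iff pi_div_three_mem_Icc_KL Dl w hf hh hr]
    intro e; rw [e, sub_self] at h₁; exact lt_irrefl _ h₁
  · rw [Ne, vertexFunctional_printed_latN_eq_zero_iff two_pi_div_three_mem_Icc_KL Dl w hf hh hr]
    intro e; rw [e, sub_self] at h₂; exact lt_irrefl _ h₂

/-- **Strict opposite signs, decreasing order** (`M_W − M_E < 0` at `π/3`, `> 0` at `2π/3`) ⇒ a zero in `(π/3, 2π/3)`.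
[cite: GlazmanManolescu2019, Lemma 2.1 (statement, "in the form given in [Gl]")] [cite: Glazman2015WeightedSAW, Lemma 3.1 (proof, pp. 6–7)]
[cite: DuminilCopinSmirnov2012, proof of Lemma 1] -/
theorem vertexFunctional_printed_latN_exists_eq_zero_Ioo_of_diff_signs' (Dl : List Face) (w : Face)
    (hf : latN w ∈ Dl) (hh : holeFaceW w ∉ dom Dl) (hr : RootedFace (dom Dl) (w.side .W) (latN w))
    (h₁ : (∑ ω ∈ ΩG.setB2a (dom Dl) (w.side .W) (latN w), ΩG.routeMassL (π / 3) hr .W ω) -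
      ∑ ω ∈ ΩG.setB2a (dom Dl) (w.side .W) (latN w), ΩG.routeMassL (π / 3) hr .E ω < 0)
    (h₂ : 0 < (∑ ω ∈ ΩG.setB2a (dom Dl) (w.side .W) (latN w), ΩG.routeMassL (2 * π / 3) hr .W ω) -
      ∑ ω ∈ ΩG.setB2a (dom Dl) (w.side .W) (latN w), ΩG.routeMassL (2 * π / 3) hr .E ω) :
    ∃ θ ∈ Set.Ioo (π / 3) (2 * π / 3),
      vertexFunctional (printedWeights θ) tFiveEighths (ybCoeff θ) Dl (w.side .W) (latN w) = 0 := by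
  refine vertexFunctional_printed_latN_exists_eq_zero_Ioo (by linarith [Real.pi_pos]) pi_div_three_mem_Icc_KL
    two_pi_div_three_mem_Icc_KL Dl w hf hh hr (mul_nonpos_of_nonpos_of_nonneg h₁.le h₂.le) ?_ ?_
  · rw [Ne, vertexFunctional_printed_latN_eq_zero_iff pi_div_three_mem_Icc_KL Dl w hf hh hr]
    intro e; rw [e, sub_self] at h₁; exact lt_irrefl _ h₁
  · rw [Ne, vertexFunctional_printed_latN_eq_zero_iff two_pi_div_three_mem_Icc_KL Dl w hf hh hr]
    intro e; rw [e, sub_self] at h₂; exact lt_irrefl _ h₂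

/-- ★★★ **KILL-FORCED ZEROS AT THE LATERAL CELL.** At the lateral cell `latN w` above the hole of the root `w.side W`,
suppose (honeycomb point) EVERY wound class-`B2a` walk that first entered the cell from `E` passes some other rhombus twice
through its two `(π − θ)`-corners while SOME wound walk that entered from `W` does not, and (dual point) EVERY wound walk
that entered from `W` passes some other rhombus twice through its two `θ`-corners while SOME wound walk that entered from
`E` does not. Then the Yang–Baxter vertex functional of the hole root vanishes EXACTLY at some `θ* ∈ (π/3, 2π/3)` at the
lateral cell (`M_W − M_E > 0` at `π/3`, `< 0` at `2π/3`, the defect is `i·v·e^{i(3θ/8+5π/8)}·(M_W − M_E)` and continuous).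
[cite: GlazmanManolescu2019, Lemma 2.1 (statement, "in the form given in [Gl]")] [cite: GlazmanManolescu2019, §1 (the paragraph of Fig. 2 and the remark after eq. (1))]
[cite: Glazman2015WeightedSAW, Lemma 3.1 (proof, pp. 6–7)] [cite: DuminilCopinSmirnov2012, proof of Lemma 1] -/
theorem vertexFunctional_printed_latN_exists_eq_zero_Ioo_of_opposite_kills (Dl : List Face) (w : Face)
    (hf : latN w ∈ Dl) (hh : holeFaceW w ∉ dom Dl) (hr : RootedFace (dom Dl) (w.side .W) (latN w))
    (hE₂ : ∀ (ω : ΩG (dom Dl) (w.side .W) (latN w)) (h : ω.IsB2a), ω.2.firstSideG = .E →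
      ω.WE (fun _ => π / 3) ≠ excursionWinding (π / 3) ω.2.firstSideG (ω.z1 hr h) ω.1 → ¬ω.2.W2FreeOff (latN w))
    (hW₂ : ∃ (ω : ΩG (dom Dl) (w.side .W) (latN w)) (h : ω.IsB2a), ω.2.firstSideG = .W ∧
      ω.WE (fun _ => π / 3) ≠ excursionWinding (π / 3) ω.2.firstSideG (ω.z1 hr h) ω.1 ∧ ω.2.W2FreeOff (latN w))
    (hW₁ : ∀ (ω : ΩG (dom Dl) (w.side .W) (latN w)) (h : ω.IsB2a), ω.2.firstSideG = .W →
      ω.WE (fun _ => 2 * π / 3) ≠ excursionWinding (2 * π / 3) ω.2.firstSideG (ω.z1 hr h) ω.1 →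
        ¬ω.2.W1FreeOff (latN w))
    (hE₁ : ∃ (ω : ΩG (dom Dl) (w.side .W) (latN w)) (h : ω.IsB2a), ω.2.firstSideG = .E ∧
      ω.WE (fun _ => 2 * π / 3) ≠ excursionWinding (2 * π / 3) ω.2.firstSideG (ω.z1 hr h) ω.1 ∧
        ω.2.W1FreeOff (latN w)) :
    ∃ θ ∈ Set.Ioo (π / 3) (2 * π / 3),
      vertexFunctional (printedWeights θ) tFiveEighths (ybCoeff θ) Dl (w.side .W) (latN w) = 0 :=
  vertexFunctional_printed_latN_exists_eq_zero_Ioo_of_diff_signs Dl w hf hh hr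
    (routeMassL_diff_pi_div_three_pos_of_east_killed Dl w hr hE₂ hW₂)
    (routeMassL_diff_two_pi_div_three_neg_of_west_killed Dl w hr hW₁ hE₁)

/-- ★★★ **KILL-FORCED ZEROS AT THE LATERAL CELL, routes exchanged**: WEST route `w₂`-killed with a `w₂`-free wound
east-walk at `π/3`, EAST route `w₁`-killed with a `w₁`-free wound west-walk at `2π/3` ⇒ an exact zero in `(π/3, 2π/3)`.
[cite: GlazmanManolescu2019, Lemma 2.1 (statement, "in the form given in [Gl]")] [cite: GlazmanManolescu2019, §1 (the paragraph of Fig. 2 and the remark after eq. (1))]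
[cite: Glazman2015WeightedSAW, Lemma 3.1 (proof, pp. 6–7)] [cite: DuminilCopinSmirnov2012, proof of Lemma 1] -/
theorem vertexFunctional_printed_latN_exists_eq_zero_Ioo_of_opposite_kills' (Dl : List Face) (w : Face)
    (hf : latN w ∈ Dl) (hh : holeFaceW w ∉ dom Dl) (hr : RootedFace (dom Dl) (w.side .W) (latN w))
    (hW₂ : ∀ (ω : ΩG (dom Dl) (w.side .W) (latN w)) (h : ω.IsB2a), ω.2.firstSideG = .W →
      ω.WE (fun _ => π / 3) ≠ excursionWinding (π / 3) ω.2.firstSideG (ω.z1 hr h) ω.1 → ¬ω.2.W2FreeOff (latN w))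
    (hE₂ : ∃ (ω : ΩG (dom Dl) (w.side .W) (latN w)) (h : ω.IsB2a), ω.2.firstSideG = .E ∧
      ω.WE (fun _ => π / 3) ≠ excursionWinding (π / 3) ω.2.firstSideG (ω.z1 hr h) ω.1 ∧ ω.2.W2FreeOff (latN w))
    (hE₁ : ∀ (ω : ΩG (dom Dl) (w.side .W) (latN w)) (h : ω.IsB2a), ω.2.firstSideG = .E →
      ω.WE (fun _ => 2 * π / 3) ≠ excursionWinding (2 * π / 3) ω.2.firstSideG (ω.z1 hr h) ω.1 →
        ¬ω.2.W1FreeOff (latN w))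
    (hW₁ : ∃ (ω : ΩG (dom Dl) (w.side .W) (latN w)) (h : ω.IsB2a), ω.2.firstSideG = .W ∧
      ω.WE (fun _ => 2 * π / 3) ≠ excursionWinding (2 * π / 3) ω.2.firstSideG (ω.z1 hr h) ω.1 ∧
        ω.2.W1FreeOff (latN w)) :
    ∃ θ ∈ Set.Ioo (π / 3) (2 * π / 3),
      vertexFunctional (printedWeights θ) tFiveEighths (ybCoeff θ) Dl (w.side .W) (latN w) = 0 :=
  vertexFunctional_printed_latN_exists_eq_zero_Ioo_of_diff_signs' Dl w hf hh hr
    (routeMassL_diff_pi_div_three_neg_of_west_killed Dl w hr hW₂ hE₂)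
    (routeMassL_diff_two_pi_div_three_pos_of_east_killed Dl w hr hE₁ hW₁)

/-- **At a kill-forced lateral zero the routes BALANCE** (`M_W(θ*) = M_E(θ*)`).
[cite: GlazmanManolescu2019, Lemma 2.1 (statement, "in the form given in [Gl]")] [cite: Glazman2015WeightedSAW, Lemma 3.1, eq. (1) (the weight v(θ))] -/
theorem routeMassL_sum_eq_at_kill_forced_zero (Dl : List Face) (w : Face)
    (hf : latN w ∈ Dl) (hh : holeFaceW w ∉ dom Dl) (hr : RootedFace (dom Dl) (w.side .W) (latN w))
    (hE₂ : ∀ (ω : ΩG (dom Dl) (w.side .W) (latN w)) (h : ω.IsB2a), ω.2.firstSideG = .E →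
      ω.WE (fun _ => π / 3) ≠ excursionWinding (π / 3) ω.2.firstSideG (ω.z1 hr h) ω.1 → ¬ω.2.W2FreeOff (latN w))
    (hW₂ : ∃ (ω : ΩG (dom Dl) (w.side .W) (latN w)) (h : ω.IsB2a), ω.2.firstSideG = .W ∧
      ω.WE (fun _ => π / 3) ≠ excursionWinding (π / 3) ω.2.firstSideG (ω.z1 hr h) ω.1 ∧ ω.2.W2FreeOff (latN w))
    (hW₁ : ∀ (ω : ΩG (dom Dl) (w.side .W) (latN w)) (h : ω.IsB2a), ω.2.firstSideG = .W →
      ω.WE (fun _ => 2 * π / 3) ≠ excursionWinding (2 * π / 3) ω.2.firstSideG (ω.z1 hr h) ω.1 →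
        ¬ω.2.W1FreeOff (latN w))
    (hE₁ : ∃ (ω : ΩG (dom Dl) (w.side .W) (latN w)) (h : ω.IsB2a), ω.2.firstSideG = .E ∧
      ω.WE (fun _ => 2 * π / 3) ≠ excursionWinding (2 * π / 3) ω.2.firstSideG (ω.z1 hr h) ω.1 ∧
        ω.2.W1FreeOff (latN w)) :
    ∃ θ ∈ Set.Ioo (π / 3) (2 * π / 3),
      ∑ ω ∈ ΩG.setB2a (dom Dl) (w.side .W) (latN w), ΩG.routeMassL θ hr .W ω =
        ∑ ω ∈ ΩG.setB2a (dom Dl) (w.side .W) (latN w), ΩG.routeMassL θ hr .E ω := by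
  obtain ⟨θ, hθ, hz⟩ :=
    vertexFunctional_printed_latN_exists_eq_zero_Ioo_of_opposite_kills Dl w hf hh hr hE₂ hW₂ hW₁ hE₁
  exact ⟨θ, hθ, (vertexFunctional_printed_latN_eq_zero_iff (Set.Ioo_subset_Icc_self hθ) Dl w hf hh hr).1 hz⟩

end LateralCell

/-! ## §7 (edition 3) KILL-FORCED ZEROS AT THE LATERAL CELL BELOW THE HOLE

The cell `latS w = (w.1 − 1, w.2 − 1)` below the hole, in the frame of `PlaquetteWalkHoleRootContinuityZeros` §E: the
rotated defect `conj(e^{i·3θ/8})·VF` is purely imaginary with imaginary part `v(θ)·Σ_{B2a} Re(conj(e^{i·3θ/8})·classTermLS)`,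
and the summand of a class-`B2a` walk is `+ext` (wound, first side `W`), `−ext` (wound, first side `E`) or `0` (unwound)
(`conj_lsRot_mul_classTermLS_of_W/_of_E`, `classTermLS_of_not_wound`). A `w₂`-kill of a route makes its wound walks'
exterior weights vanish at `π/3`, a `w₁`-kill at `2π/3`. -/

section LateralCellSouthKills

/-- The rotated class term at `latS` as a real number: `+ext`, `−ext` or `0`. [folklore] -/
private theorem re_conj_lsRot_mul_classTermLS_cases {D : Set Face} {w : Face} (hh : holeFaceW w ∉ D) (θ : ℝ)
    (hr : RootedFace D (w.side .W) (latS w)) (ω : ΩG D (w.side .W) (latS w)) (h : ω.IsB2a) :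
    (¬ ω.WE (fun _ => θ) ≠ excursionWinding θ ω.2.firstSideG (ω.z1 hr h) ω.1 ∧
        ((starRingEnd ℂ) (Complex.exp ((((3 * θ / 8 : ℝ)) : ℂ) * Complex.I)) * ΩG.classTermLS θ hr ω).re = 0) ∨
      (ω.WE (fun _ => θ) ≠ excursionWinding θ ω.2.firstSideG (ω.z1 hr h) ω.1 ∧ ω.2.firstSideG = .W ∧
        ((starRingEnd ℂ) (Complex.exp ((((3 * θ / 8 : ℝ)) : ℂ) * Complex.I)) * ΩG.classTermLS θ hr ω).re =
          ω.2.extWeight (fun _ => θ) (latS w)) ∨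
      (ω.WE (fun _ => θ) ≠ excursionWinding θ ω.2.firstSideG (ω.z1 hr h) ω.1 ∧ ω.2.firstSideG = .E ∧
        ((starRingEnd ℂ) (Complex.exp ((((3 * θ / 8 : ℝ)) : ℂ) * Complex.I)) * ΩG.classTermLS θ hr ω).re =
          -ω.2.extWeight (fun _ => θ) (latS w)) := by
  by_cases hw : ω.WE (fun _ => θ) ≠ excursionWinding θ ω.2.firstSideG (ω.z1 hr h) ω.1
  · rcases ΩG.LS_firstSide_eq_E_or_W hh hr h with hz | hz
    · refine Or.inr (Or.inr ⟨hw, hz, ?_⟩)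
      rw [conj_lsRot_mul_classTermLS_of_E hh θ hr ω h hw hz]
      simp
    · refine Or.inr (Or.inl ⟨hw, hz, ?_⟩)
      rw [conj_lsRot_mul_classTermLS_of_W hh θ hr ω h hw hz]
      simp
  · refine Or.inl ⟨hw, ?_⟩
    rw [classTermLS_of_not_wound θ hr ω h hw, mul_zero, Complex.zero_re]

/-- Exterior weights are non-negative on the printed range. [cite: GlazmanManolescu2019, eq. (1) (the weights are non-negative)] -/
private theorem extWeight_nonneg_KL {θ : ℝ} (hθ : θ ∈ Set.Icc (π / 3) (2 * π / 3)) {D : Set Face} {a z : MidEdge}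
    (γ : YBWalk D a z) (r : Face) : 0 ≤ γ.extWeight (fun _ => θ) r := by
  unfold YBWalk.extWeight
  exact Finset.prod_nonneg fun _ _ => localWeight_nonneg hθ _

/-- ★ **WEST-ROUTE `w₂`-KILL BELOW THE HOLE ⇒ the signed wound mass is NEGATIVE at `θ = π/3`.** Every wound walk at
`latS` that entered from `W` is `w₂`-marked (its exterior weight vanishes at the honeycomb point), some wound walk that
entered from `E` is `w₂`-free (its term is `−x_c^ℓ < 0`). [cite: GlazmanManolescu2019, Lemma 2.1 (statement, "in the form given in [Gl]")]
[cite: GlazmanManolescu2019, §1 (the paragraph of Fig. 2: «if θ = π/3, then w₂ = 0»)] -/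
theorem signedMassLS_pi_div_three_neg_of_west_killed (Dl : List Face) (w : Face) (hh : holeFaceW w ∉ dom Dl)
    (hr : RootedFace (dom Dl) (w.side .W) (latS w))
    (hW : ∀ (ω : ΩG (dom Dl) (w.side .W) (latS w)) (h : ω.IsB2a), ω.2.firstSideG = .W →
      ω.WE (fun _ => π / 3) ≠ excursionWinding (π / 3) ω.2.firstSideG (ω.z1 hr h) ω.1 → ¬ω.2.W2FreeOff (latS w))
    (hE : ∃ (ω : ΩG (dom Dl) (w.side .W) (latS w)) (h : ω.IsB2a), ω.2.firstSideG = .E ∧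
      ω.WE (fun _ => π / 3) ≠ excursionWinding (π / 3) ω.2.firstSideG (ω.z1 hr h) ω.1 ∧ ω.2.W2FreeOff (latS w)) :
    ∑ ω ∈ ΩG.setB2a (dom Dl) (w.side .W) (latS w),
        ((starRingEnd ℂ) (Complex.exp ((((3 * (π / 3) / 8 : ℝ)) : ℂ) * Complex.I)) *
          ΩG.classTermLS (π / 3) hr ω).re < 0 := by
  classical
  -- every term is ≤ 0
  have hle : ∀ ω ∈ ΩG.setB2a (dom Dl) (w.side .W) (latS w),
      ((starRingEnd ℂ) (Complex.exp ((((3 * (π / 3) / 8 : ℝ)) : ℂ) * Complex.I)) *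
        ΩG.classTermLS (π / 3) hr ω).re ≤ 0 := by
    intro ω hω
    simp only [ΩG.setB2a, Finset.mem_filter, Finset.mem_univ, true_and] at hω
    rcases re_conj_lsRot_mul_classTermLS_cases hh (π / 3) hr ω hω with ⟨_, h0⟩ | ⟨hw, hz, hW'⟩ | ⟨_, _, hE'⟩
    · rw [h0]
    · rw [hW', ω.2.extWeight_pi_div_three_eq_zero _ (hW ω hω hz hw)]
    · rw [hE', neg_nonpos]
      exact extWeight_nonneg_KL ⟨le_rfl, by linarith [Real.pi_pos]⟩ _ _
  -- the witness term is < 0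
  obtain ⟨ω₀, h₀, hz₀, hw₀, hF₀⟩ := hE
  have hmem : ω₀ ∈ ΩG.setB2a (dom Dl) (w.side .W) (latS w) := by
    simp only [ΩG.setB2a, Finset.mem_filter, Finset.mem_univ, true_and]; exact h₀
  have hlt : ((starRingEnd ℂ) (Complex.exp ((((3 * (π / 3) / 8 : ℝ)) : ℂ) * Complex.I)) *
      ΩG.classTermLS (π / 3) hr ω₀).re < 0 := by
    rw [conj_lsRot_mul_classTermLS_of_E hh (π / 3) hr ω₀ h₀ hw₀ hz₀]
    simp only [Complex.neg_re, Complex.ofReal_re, neg_lt_zero]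
    exact ω₀.2.extWeight_pi_div_three_pos _ hF₀
  rw [← Finset.add_sum_erase _ _ hmem]
  have hrest : (∑ x ∈ (ΩG.setB2a (dom Dl) (w.side .W) (latS w)).erase ω₀,
        ((starRingEnd ℂ) (Complex.exp ((((3 * (π / 3) / 8 : ℝ)) : ℂ) * Complex.I)) *
          ΩG.classTermLS (π / 3) hr x).re) ≤ 0 :=
    Finset.sum_nonpos fun ω hω => hle ω (Finset.mem_of_mem_erase hω)
  linarith

/-- ★ **EAST-ROUTE `w₂`-KILL BELOW THE HOLE ⇒ the signed wound mass is POSITIVE at `θ = π/3`.**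
[cite: GlazmanManolescu2019, Lemma 2.1 (statement, "in the form given in [Gl]")] [cite: GlazmanManolescu2019, §1 (the paragraph of Fig. 2)] -/
theorem signedMassLS_pi_div_three_pos_of_east_killed (Dl : List Face) (w : Face) (hh : holeFaceW w ∉ dom Dl)
    (hr : RootedFace (dom Dl) (w.side .W) (latS w))
    (hE : ∀ (ω : ΩG (dom Dl) (w.side .W) (latS w)) (h : ω.IsB2a), ω.2.firstSideG = .E →
      ω.WE (fun _ => π / 3) ≠ excursionWinding (π / 3) ω.2.firstSideG (ω.z1 hr h) ω.1 → ¬ω.2.W2FreeOff (latS w))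
    (hW : ∃ (ω : ΩG (dom Dl) (w.side .W) (latS w)) (h : ω.IsB2a), ω.2.firstSideG = .W ∧
      ω.WE (fun _ => π / 3) ≠ excursionWinding (π / 3) ω.2.firstSideG (ω.z1 hr h) ω.1 ∧ ω.2.W2FreeOff (latS w)) :
    0 < ∑ ω ∈ ΩG.setB2a (dom Dl) (w.side .W) (latS w),
        ((starRingEnd ℂ) (Complex.exp ((((3 * (π / 3) / 8 : ℝ)) : ℂ) * Complex.I)) *
          ΩG.classTermLS (π / 3) hr ω).re := by
  classical
  have hle : ∀ ω ∈ ΩG.setB2a (dom Dl) (w.side .W) (latS w),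
      0 ≤ ((starRingEnd ℂ) (Complex.exp ((((3 * (π / 3) / 8 : ℝ)) : ℂ) * Complex.I)) *
        ΩG.classTermLS (π / 3) hr ω).re := by
    intro ω hω
    simp only [ΩG.setB2a, Finset.mem_filter, Finset.mem_univ, true_and] at hω
    rcases re_conj_lsRot_mul_classTermLS_cases hh (π / 3) hr ω hω with ⟨_, h0⟩ | ⟨_, _, hW'⟩ | ⟨hw, hz, hE'⟩
    · rw [h0]
    · rw [hW']
      exact extWeight_nonneg_KL ⟨le_rfl, by linarith [Real.pi_pos]⟩ _ _
    · rw [hE', ω.2.extWeight_pi_div_three_eq_zero _ (hE ω hω hz hw), neg_zero]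
  obtain ⟨ω₀, h₀, hz₀, hw₀, hF₀⟩ := hW
  have hmem : ω₀ ∈ ΩG.setB2a (dom Dl) (w.side .W) (latS w) := by
    simp only [ΩG.setB2a, Finset.mem_filter, Finset.mem_univ, true_and]; exact h₀
  have hlt : 0 < ((starRingEnd ℂ) (Complex.exp ((((3 * (π / 3) / 8 : ℝ)) : ℂ) * Complex.I)) *
      ΩG.classTermLS (π / 3) hr ω₀).re := by
    rw [conj_lsRot_mul_classTermLS_of_W hh (π / 3) hr ω₀ h₀ hw₀ hz₀]
    simp only [Complex.ofReal_re]
    exact ω₀.2.extWeight_pi_div_three_pos _ hF₀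
  rw [← Finset.add_sum_erase _ _ hmem]
  have hrest : 0 ≤ (∑ x ∈ (ΩG.setB2a (dom Dl) (w.side .W) (latS w)).erase ω₀,
        ((starRingEnd ℂ) (Complex.exp ((((3 * (π / 3) / 8 : ℝ)) : ℂ) * Complex.I)) *
          ΩG.classTermLS (π / 3) hr x).re) :=
    Finset.sum_nonneg fun ω hω => hle ω (Finset.mem_of_mem_erase hω)
  linarith

/-- ★ **EAST-ROUTE `w₁`-KILL BELOW THE HOLE ⇒ the signed wound mass is POSITIVE at `θ = 2π/3`.**
[cite: GlazmanManolescu2019, Lemma 2.1 (statement, "in the form given in [Gl]")] [cite: GlazmanManolescu2019, §1, remark after eq. (1)] -/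
theorem signedMassLS_two_pi_div_three_pos_of_east_killed (Dl : List Face) (w : Face) (hh : holeFaceW w ∉ dom Dl)
    (hr : RootedFace (dom Dl) (w.side .W) (latS w))
    (hE : ∀ (ω : ΩG (dom Dl) (w.side .W) (latS w)) (h : ω.IsB2a), ω.2.firstSideG = .E →
      ω.WE (fun _ => 2 * π / 3) ≠ excursionWinding (2 * π / 3) ω.2.firstSideG (ω.z1 hr h) ω.1 →
        ¬ω.2.W1FreeOff (latS w))
    (hW : ∃ (ω : ΩG (dom Dl) (w.side .W) (latS w)) (h : ω.IsB2a), ω.2.firstSideG = .W ∧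
      ω.WE (fun _ => 2 * π / 3) ≠ excursionWinding (2 * π / 3) ω.2.firstSideG (ω.z1 hr h) ω.1 ∧
        ω.2.W1FreeOff (latS w)) :
    0 < ∑ ω ∈ ΩG.setB2a (dom Dl) (w.side .W) (latS w),
        ((starRingEnd ℂ) (Complex.exp ((((3 * (2 * π / 3) / 8 : ℝ)) : ℂ) * Complex.I)) *
          ΩG.classTermLS (2 * π / 3) hr ω).re := by
  classical
  have hθ : (2 * π / 3 : ℝ) ∈ Set.Icc (π / 3) (2 * π / 3) := ⟨by linarith [Real.pi_pos], le_rfl⟩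
  have hle : ∀ ω ∈ ΩG.setB2a (dom Dl) (w.side .W) (latS w),
      0 ≤ ((starRingEnd ℂ) (Complex.exp ((((3 * (2 * π / 3) / 8 : ℝ)) : ℂ) * Complex.I)) *
        ΩG.classTermLS (2 * π / 3) hr ω).re := by
    intro ω hω
    simp only [ΩG.setB2a, Finset.mem_filter, Finset.mem_univ, true_and] at hω
    rcases re_conj_lsRot_mul_classTermLS_cases hh (2 * π / 3) hr ω hω with ⟨_, h0⟩ | ⟨_, _, hW'⟩ | ⟨hw, hz, hE'⟩
    · rw [h0]
    · rw [hW']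
      exact extWeight_nonneg_KL hθ _ _
    · rw [hE', ω.2.extWeight_two_pi_div_three_eq_zero _ (hE ω hω hz hw), neg_zero]
  obtain ⟨ω₀, h₀, hz₀, hw₀, hF₀⟩ := hW
  have hmem : ω₀ ∈ ΩG.setB2a (dom Dl) (w.side .W) (latS w) := by
    simp only [ΩG.setB2a, Finset.mem_filter, Finset.mem_univ, true_and]; exact h₀
  have hlt : 0 < ((starRingEnd ℂ) (Complex.exp ((((3 * (2 * π / 3) / 8 : ℝ)) : ℂ) * Complex.I)) *
      ΩG.classTermLS (2 * π / 3) hr ω₀).re := by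
    rw [conj_lsRot_mul_classTermLS_of_W hh (2 * π / 3) hr ω₀ h₀ hw₀ hz₀]
    simp only [Complex.ofReal_re]
    exact ω₀.2.extWeight_two_pi_div_three_pos _ hF₀
  rw [← Finset.add_sum_erase _ _ hmem]
  have hrest : 0 ≤ (∑ x ∈ (ΩG.setB2a (dom Dl) (w.side .W) (latS w)).erase ω₀,
        ((starRingEnd ℂ) (Complex.exp ((((3 * (2 * π / 3) / 8 : ℝ)) : ℂ) * Complex.I)) *
          ΩG.classTermLS (2 * π / 3) hr x).re) :=
    Finset.sum_nonneg fun ω hω => hle ω (Finset.mem_of_mem_erase hω)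
  linarith

/-- ★ **WEST-ROUTE `w₁`-KILL BELOW THE HOLE ⇒ the signed wound mass is NEGATIVE at `θ = 2π/3`.**
[cite: GlazmanManolescu2019, Lemma 2.1 (statement, "in the form given in [Gl]")] [cite: GlazmanManolescu2019, §1, remark after eq. (1)] -/
theorem signedMassLS_two_pi_div_three_neg_of_west_killed (Dl : List Face) (w : Face) (hh : holeFaceW w ∉ dom Dl)
    (hr : RootedFace (dom Dl) (w.side .W) (latS w))
    (hW : ∀ (ω : ΩG (dom Dl) (w.side .W) (latS w)) (h : ω.IsB2a), ω.2.firstSideG = .W →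
      ω.WE (fun _ => 2 * π / 3) ≠ excursionWinding (2 * π / 3) ω.2.firstSideG (ω.z1 hr h) ω.1 →
        ¬ω.2.W1FreeOff (latS w))
    (hE : ∃ (ω : ΩG (dom Dl) (w.side .W) (latS w)) (h : ω.IsB2a), ω.2.firstSideG = .E ∧
      ω.WE (fun _ => 2 * π / 3) ≠ excursionWinding (2 * π / 3) ω.2.firstSideG (ω.z1 hr h) ω.1 ∧
        ω.2.W1FreeOff (latS w)) :
    ∑ ω ∈ ΩG.setB2a (dom Dl) (w.side .W) (latS w),
        ((starRingEnd ℂ) (Complex.exp ((((3 * (2 * π / 3) / 8 : ℝ)) : ℂ) * Complex.I)) *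
          ΩG.classTermLS (2 * π / 3) hr ω).re < 0 := by
  classical
  have hθ : (2 * π / 3 : ℝ) ∈ Set.Icc (π / 3) (2 * π / 3) := ⟨by linarith [Real.pi_pos], le_rfl⟩
  have hle : ∀ ω ∈ ΩG.setB2a (dom Dl) (w.side .W) (latS w),
      ((starRingEnd ℂ) (Complex.exp ((((3 * (2 * π / 3) / 8 : ℝ)) : ℂ) * Complex.I)) *
        ΩG.classTermLS (2 * π / 3) hr ω).re ≤ 0 := by
    intro ω hω
    simp only [ΩG.setB2a, Finset.mem_filter, Finset.mem_univ, true_and] at hω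
    rcases re_conj_lsRot_mul_classTermLS_cases hh (2 * π / 3) hr ω hω with ⟨_, h0⟩ | ⟨hw, hz, hW'⟩ | ⟨_, _, hE'⟩
    · rw [h0]
    · rw [hW', ω.2.extWeight_two_pi_div_three_eq_zero _ (hW ω hω hz hw)]
    · rw [hE', neg_nonpos]
      exact extWeight_nonneg_KL hθ _ _
  obtain ⟨ω₀, h₀, hz₀, hw₀, hF₀⟩ := hE
  have hmem : ω₀ ∈ ΩG.setB2a (dom Dl) (w.side .W) (latS w) := by
    simp only [ΩG.setB2a, Finset.mem_filter, Finset.mem_univ, true_and]; exact h₀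
  have hlt : ((starRingEnd ℂ) (Complex.exp ((((3 * (2 * π / 3) / 8 : ℝ)) : ℂ) * Complex.I)) *
      ΩG.classTermLS (2 * π / 3) hr ω₀).re < 0 := by
    rw [conj_lsRot_mul_classTermLS_of_E hh (2 * π / 3) hr ω₀ h₀ hw₀ hz₀]
    simp only [Complex.neg_re, Complex.ofReal_re, neg_lt_zero]
    exact ω₀.2.extWeight_two_pi_div_three_pos _ hF₀
  rw [← Finset.add_sum_erase _ _ hmem]
  have hrest : (∑ x ∈ (ΩG.setB2a (dom Dl) (w.side .W) (latS w)).erase ω₀,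
        ((starRingEnd ℂ) (Complex.exp ((((3 * (2 * π / 3) / 8 : ℝ)) : ℂ) * Complex.I)) *
          ΩG.classTermLS (2 * π / 3) hr x).re) ≤ 0 :=
    Finset.sum_nonpos fun ω hω => hle ω (Finset.mem_of_mem_erase hω)
  linarith

/-- A non-zero signed wound mass below the hole means a non-zero defect there (the rotated defect is `i·v·(signed mass)`
with `v > 0`). [cite: GlazmanManolescu2019, Lemma 2.1 (statement, "in the form given in [Gl]")] [cite: Glazman2015WeightedSAW, Lemma 3.1, eq. (1) (the weight v(θ))] -/
theorem vertexFunctional_printed_latS_ne_zero_of_signedMass_ne_zero {θ : ℝ} (hθ : θ ∈ Set.Icc (π / 3) (2 * π / 3))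
    (Dl : List Face) (w : Face) (hf : latS w ∈ Dl) (hh : holeFaceW w ∉ dom Dl)
    (hr : RootedFace (dom Dl) (w.side .W) (latS w))
    (hS : ∑ ω ∈ ΩG.setB2a (dom Dl) (w.side .W) (latS w),
        ((starRingEnd ℂ) (Complex.exp ((((3 * θ / 8 : ℝ)) : ℂ) * Complex.I)) * ΩG.classTermLS θ hr ω).re ≠ 0) :
    vertexFunctional (printedWeights θ) tFiveEighths (ybCoeff θ) Dl (w.side .W) (latS w) ≠ 0 := by
  intro h0
  have him := (conj_lsRot_mul_vertexFunctional_printed_latS_re_im hθ Dl w hf hh hr).2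
  rw [h0, mul_zero, Complex.zero_im] at him
  have hv : 0 < weightV θ :=
    weightV_pos_of_mem_Ioo ⟨by linarith [hθ.1, Real.pi_pos], by linarith [hθ.2, Real.pi_pos]⟩
  exact hS ((mul_eq_zero.1 him.symm).resolve_left hv.ne')

/-- ★★★ **KILL-FORCED ZEROS BELOW THE HOLE.** At the lateral cell `latS w` below the hole of the root `w.side W`:
EVERY wound class-`B2a` walk that entered from `W` is `w₂`-marked while SOME wound walk that entered from `E` is
`w₂`-free (honeycomb point: signed mass `< 0`), and EVERY wound walk that entered from `E` is `w₁`-marked while SOME wound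
walk that entered from `W` is `w₁`-free (dual point: signed mass `> 0`) ⇒ the Yang–Baxter vertex functional of the hole
root vanishes EXACTLY at some `θ* ∈ (π/3, 2π/3)` at that cell. (The venture lane's first lateral-cell zero,
`6×5 ∖ {(3,2),(0,4),(5,0),(1,0)}` at `(3,1)`, `θ* ≈ 0.66665·π`, is of this kind: west-walks 80 wound / 0 `w₂`-free /
16 `w₁`-free, east-walks 960 / 376 / 0.) [cite: GlazmanManolescu2019, Lemma 2.1 (statement, "in the form given in [Gl]")]
[cite: GlazmanManolescu2019, §1 (the paragraph of Fig. 2 and the remark after eq. (1))]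
[cite: Glazman2015WeightedSAW, Lemma 3.1 (proof, pp. 6–7)] [cite: DuminilCopinSmirnov2012, proof of Lemma 1] -/
theorem vertexFunctional_printed_latS_exists_eq_zero_Ioo_of_opposite_kills (Dl : List Face) (w : Face)
    (hf : latS w ∈ Dl) (hh : holeFaceW w ∉ dom Dl) (hr : RootedFace (dom Dl) (w.side .W) (latS w))
    (hW₂ : ∀ (ω : ΩG (dom Dl) (w.side .W) (latS w)) (h : ω.IsB2a), ω.2.firstSideG = .W →
      ω.WE (fun _ => π / 3) ≠ excursionWinding (π / 3) ω.2.firstSideG (ω.z1 hr h) ω.1 → ¬ω.2.W2FreeOff (latS w))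
    (hE₂ : ∃ (ω : ΩG (dom Dl) (w.side .W) (latS w)) (h : ω.IsB2a), ω.2.firstSideG = .E ∧
      ω.WE (fun _ => π / 3) ≠ excursionWinding (π / 3) ω.2.firstSideG (ω.z1 hr h) ω.1 ∧ ω.2.W2FreeOff (latS w))
    (hE₁ : ∀ (ω : ΩG (dom Dl) (w.side .W) (latS w)) (h : ω.IsB2a), ω.2.firstSideG = .E →
      ω.WE (fun _ => 2 * π / 3) ≠ excursionWinding (2 * π / 3) ω.2.firstSideG (ω.z1 hr h) ω.1 →
        ¬ω.2.W1FreeOff (latS w))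
    (hW₁ : ∃ (ω : ΩG (dom Dl) (w.side .W) (latS w)) (h : ω.IsB2a), ω.2.firstSideG = .W ∧
      ω.WE (fun _ => 2 * π / 3) ≠ excursionWinding (2 * π / 3) ω.2.firstSideG (ω.z1 hr h) ω.1 ∧
        ω.2.W1FreeOff (latS w)) :
    ∃ θ ∈ Set.Ioo (π / 3) (2 * π / 3),
      vertexFunctional (printedWeights θ) tFiveEighths (ybCoeff θ) Dl (w.side .W) (latS w) = 0 := by
  have h₁ := signedMassLS_pi_div_three_neg_of_west_killed Dl w hh hr hW₂ hE₂
  have h₂ := signedMassLS_two_pi_div_three_pos_of_east_killed Dl w hh hr hE₁ hW₁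
  have hθ₁ : (π / 3 : ℝ) ∈ Set.Icc (π / 3) (2 * π / 3) := ⟨le_rfl, by linarith [Real.pi_pos]⟩
  have hθ₂ : (2 * π / 3 : ℝ) ∈ Set.Icc (π / 3) (2 * π / 3) := ⟨by linarith [Real.pi_pos], le_rfl⟩
  exact vertexFunctional_printed_latS_exists_eq_zero_Ioo (by linarith [Real.pi_pos]) hθ₁ hθ₂ Dl w hf hh hr
    (mul_nonpos_of_nonpos_of_nonneg h₁.le h₂.le)
    (vertexFunctional_printed_latS_ne_zero_of_signedMass_ne_zero hθ₁ Dl w hf hh hr h₁.ne)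
    (vertexFunctional_printed_latS_ne_zero_of_signedMass_ne_zero hθ₂ Dl w hf hh hr h₂.ne')

/-- ★★★ **KILL-FORCED ZEROS BELOW THE HOLE, routes exchanged**: EAST route `w₂`-killed with a `w₂`-free wound west-walk
at `π/3` (signed mass `> 0`), WEST route `w₁`-killed with a `w₁`-free wound east-walk at `2π/3` (signed mass `< 0`) ⇒ an
exact zero below the hole in `(π/3, 2π/3)`. [cite: GlazmanManolescu2019, Lemma 2.1 (statement, "in the form given in [Gl]")]
[cite: GlazmanManolescu2019, §1 (the paragraph of Fig. 2 and the remark after eq. (1))]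
[cite: Glazman2015WeightedSAW, Lemma 3.1 (proof, pp. 6–7)] [cite: DuminilCopinSmirnov2012, proof of Lemma 1] -/
theorem vertexFunctional_printed_latS_exists_eq_zero_Ioo_of_opposite_kills' (Dl : List Face) (w : Face)
    (hf : latS w ∈ Dl) (hh : holeFaceW w ∉ dom Dl) (hr : RootedFace (dom Dl) (w.side .W) (latS w))
    (hE₂ : ∀ (ω : ΩG (dom Dl) (w.side .W) (latS w)) (h : ω.IsB2a), ω.2.firstSideG = .E →
      ω.WE (fun _ => π / 3) ≠ excursionWinding (π / 3) ω.2.firstSideG (ω.z1 hr h) ω.1 → ¬ω.2.W2FreeOff (latS w))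
    (hW₂ : ∃ (ω : ΩG (dom Dl) (w.side .W) (latS w)) (h : ω.IsB2a), ω.2.firstSideG = .W ∧
      ω.WE (fun _ => π / 3) ≠ excursionWinding (π / 3) ω.2.firstSideG (ω.z1 hr h) ω.1 ∧ ω.2.W2FreeOff (latS w))
    (hW₁ : ∀ (ω : ΩG (dom Dl) (w.side .W) (latS w)) (h : ω.IsB2a), ω.2.firstSideG = .W →
      ω.WE (fun _ => 2 * π / 3) ≠ excursionWinding (2 * π / 3) ω.2.firstSideG (ω.z1 hr h) ω.1 →
        ¬ω.2.W1FreeOff (latS w))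
    (hE₁ : ∃ (ω : ΩG (dom Dl) (w.side .W) (latS w)) (h : ω.IsB2a), ω.2.firstSideG = .E ∧
      ω.WE (fun _ => 2 * π / 3) ≠ excursionWinding (2 * π / 3) ω.2.firstSideG (ω.z1 hr h) ω.1 ∧
        ω.2.W1FreeOff (latS w)) :
    ∃ θ ∈ Set.Ioo (π / 3) (2 * π / 3),
      vertexFunctional (printedWeights θ) tFiveEighths (ybCoeff θ) Dl (w.side .W) (latS w) = 0 := by
  have h₁ := signedMassLS_pi_div_three_pos_of_east_killed Dl w hh hr hE₂ hW₂
  have h₂ := signedMassLS_two_pi_div_three_neg_of_west_killed Dl w hh hr hW₁ hE₁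
  have hθ₁ : (π / 3 : ℝ) ∈ Set.Icc (π / 3) (2 * π / 3) := ⟨le_rfl, by linarith [Real.pi_pos]⟩
  have hθ₂ : (2 * π / 3 : ℝ) ∈ Set.Icc (π / 3) (2 * π / 3) := ⟨by linarith [Real.pi_pos], le_rfl⟩
  exact vertexFunctional_printed_latS_exists_eq_zero_Ioo (by linarith [Real.pi_pos]) hθ₁ hθ₂ Dl w hf hh hr
    (mul_nonpos_of_nonneg_of_nonpos h₁.le h₂.le)
    (vertexFunctional_printed_latS_ne_zero_of_signedMass_ne_zero hθ₁ Dl w hf hh hr h₁.ne')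
    (vertexFunctional_printed_latS_ne_zero_of_signedMass_ne_zero hθ₂ Dl w hf hh hr h₂.ne)

end LateralCellSouthKills

end Literature.Barriers.CriticalPhenomena.PlaquetteWalk

/-! ## §8 (edition 4) KILL-FORCED ZEROS AT ANY CELL WITH TWO ANTIPODAL LETTERS

Frame: the LETTER LAWS (`PlaquetteWalkHoleRootLetterLaws`). At a cell `c` of the `W`-normalised hole root `w.side W`
(`c.side t ≠ w.side W` for all `t`, hole `(w.1 − 1, w.2) ∉ D`) every wound class-`B2a` walk carries a letter
`ΩG.letterAt` (a unit complex number) and a wound mass `ΩG.woundMassAt`; `ΩG.letterMass u` is the total wound mass of the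
letter `u`, and when only the two opposite letters `±u` occur, `VF = i·v(θ)·u·(M(u) − M(−u))`
(`vertexFunctional_printed_cell_eq_of_antipodal_letters`). Letters of the rotating kind depend on `θ`; the theorem below
therefore takes a letter FUNCTION `u : ℝ → ℂ`, continuous and non-vanishing on the printed range. -/

namespace Literature.Probability.RandomPlanarGeometry.SAW.YangBaxter

open Real

namespace ΩG

variable {D : Set Face} {w r : Face} [Finite D]

/-- **A `w₂`-killed letter has letter mass ZERO at `θ = π/3`**: if every wound class-`B2a` walk at `r` whose letter at
`π/3` is `u` passes some rhombus other than `r` twice through its two `(π − θ)`-corners, then `M(u)(π/3) = 0`.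
[cite: GlazmanManolescu2019, §1 (the paragraph of Fig. 2: «if θ = π/3, then w₂ = 0»)] [cite: Glazman2015WeightedSAW, Lemma 3.1 (proof, pp. 6–7)] -/
theorem letterMass_pi_div_three_eq_zero_of_killed (hh : ((w.1 - 1, w.2) : Face) ∉ D) (hr : RootedFace D (w.side .W) r)
    (u : ℂ)
    (hK : ∀ (ω : ΩG D (w.side .W) r) (h : ω.IsB2a),
      ω.WE (fun _ => π / 3) ≠ excursionWinding (π / 3) ω.2.firstSideG (ω.z1 hr h) ω.1 →
        letterAt hh (π / 3) hr ω = u → ¬ω.2.W2FreeOff r) :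
    letterMass hh (π / 3) hr u = 0 := by
  classical
  unfold letterMass
  refine Finset.sum_eq_zero fun ω _ => ?_
  split_ifs with hu
  · by_contra hne
    obtain ⟨h, hW⟩ := exists_wound_of_woundMassAt_ne_zero hr ω hne
    exact hne (woundMassAt_eq_zero_of_extWeight hr ω (ω.2.extWeight_pi_div_three_eq_zero _ (hK ω h hW hu)))
  · rfl

/-- **A letter with a `w₂`-free wound walk has POSITIVE letter mass at `θ = π/3`.**
[cite: GlazmanManolescu2019, §4 (first paragraph)] [cite: Glazman2015WeightedSAW, Lemma 3.1 (proof, pp. 6–7)] -/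
theorem letterMass_pi_div_three_pos_of_free (hh : ((w.1 - 1, w.2) : Face) ∉ D) (hr : RootedFace D (w.side .W) r)
    (u : ℂ)
    (hF : ∃ (ω : ΩG D (w.side .W) r) (h : ω.IsB2a),
      ω.WE (fun _ => π / 3) ≠ excursionWinding (π / 3) ω.2.firstSideG (ω.z1 hr h) ω.1 ∧
        letterAt hh (π / 3) hr ω = u ∧ ω.2.W2FreeOff r) :
    0 < letterMass hh (π / 3) hr u := by
  classical
  have hθ : (π / 3 : ℝ) ∈ Set.Icc (π / 3) (2 * π / 3) := ⟨le_rfl, by linarith [Real.pi_pos]⟩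
  obtain ⟨ω₀, h₀, hW₀, hu₀, hF₀⟩ := hF
  have hmem : ω₀ ∈ setB2a D (w.side .W) r := by
    simp only [setB2a, Finset.mem_filter, Finset.mem_univ, true_and]; exact h₀
  unfold letterMass
  refine lt_of_lt_of_le ?_ (Finset.single_le_sum (fun ω _ => ?_) hmem)
  · rw [if_pos hu₀, woundMassAt_of_wound hr ω₀ h₀ hW₀]
    exact ω₀.2.extWeight_pi_div_three_pos _ hF₀
  · split_ifs
    · exact woundMassAt_nonneg hθ hr ω
    · exact le_rfl

/-- **A `w₁`-killed letter has letter mass ZERO at `θ = 2π/3`.** [cite: GlazmanManolescu2019, §1, remark after eq. (1)]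
[cite: Glazman2015WeightedSAW, Lemma 3.1 (proof, pp. 6–7)] -/
theorem letterMass_two_pi_div_three_eq_zero_of_killed (hh : ((w.1 - 1, w.2) : Face) ∉ D)
    (hr : RootedFace D (w.side .W) r) (u : ℂ)
    (hK : ∀ (ω : ΩG D (w.side .W) r) (h : ω.IsB2a),
      ω.WE (fun _ => 2 * π / 3) ≠ excursionWinding (2 * π / 3) ω.2.firstSideG (ω.z1 hr h) ω.1 →
        letterAt hh (2 * π / 3) hr ω = u → ¬ω.2.W1FreeOff r) :
    letterMass hh (2 * π / 3) hr u = 0 := by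
  classical
  unfold letterMass
  refine Finset.sum_eq_zero fun ω _ => ?_
  split_ifs with hu
  · by_contra hne
    obtain ⟨h, hW⟩ := exists_wound_of_woundMassAt_ne_zero hr ω hne
    exact hne (woundMassAt_eq_zero_of_extWeight hr ω (ω.2.extWeight_two_pi_div_three_eq_zero _ (hK ω h hW hu)))
  · rfl

/-- **A letter with a `w₁`-free wound walk has POSITIVE letter mass at `θ = 2π/3`.**
[cite: GlazmanManolescu2019, §1, remark after eq. (1)] [cite: Glazman2015WeightedSAW, Lemma 3.1 (proof, pp. 6–7)] -/
theorem letterMass_two_pi_div_three_pos_of_free (hh : ((w.1 - 1, w.2) : Face) ∉ D) (hr : RootedFace D (w.side .W) r)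
    (u : ℂ)
    (hF : ∃ (ω : ΩG D (w.side .W) r) (h : ω.IsB2a),
      ω.WE (fun _ => 2 * π / 3) ≠ excursionWinding (2 * π / 3) ω.2.firstSideG (ω.z1 hr h) ω.1 ∧
        letterAt hh (2 * π / 3) hr ω = u ∧ ω.2.W1FreeOff r) :
    0 < letterMass hh (2 * π / 3) hr u := by
  classical
  have hθ : (2 * π / 3 : ℝ) ∈ Set.Icc (π / 3) (2 * π / 3) := ⟨by linarith [Real.pi_pos], le_rfl⟩
  obtain ⟨ω₀, h₀, hW₀, hu₀, hF₀⟩ := hF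
  have hmem : ω₀ ∈ setB2a D (w.side .W) r := by
    simp only [setB2a, Finset.mem_filter, Finset.mem_univ, true_and]; exact h₀
  unfold letterMass
  refine lt_of_lt_of_le ?_ (Finset.single_le_sum (fun ω _ => ?_) hmem)
  · rw [if_pos hu₀, woundMassAt_of_wound hr ω₀ h₀ hW₀]
    exact ω₀.2.extWeight_two_pi_div_three_pos _ hF₀
  · split_ifs
    · exact woundMassAt_nonneg hθ hr ω
    · exact le_rfl

end ΩG

end Literature.Probability.RandomPlanarGeometry.SAW.YangBaxter

namespace Literature.Barriers.CriticalPhenomena.PlaquetteWalk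

open Literature.Probability.RandomPlanarGeometry.SAW.YangBaxter
open Real Complex

section AntipodalLetters

/-- **The rotated defect of a two-antipodal-letter cell**: `conj(u)·VF = i·v(θ)·‖u‖²·(M(u) − M(−u))`, so its real part
vanishes and its imaginary part is `v·‖u‖²·(M(u) − M(−u))`. [cite: GlazmanManolescu2019, Lemma 2.1 (statement, "in the form given in [Gl]")]
[cite: Glazman2015WeightedSAW, Lemma 3.1 (proof, pp. 6–7)] -/
theorem re_im_conj_mul_vertexFunctional_printed_cell_of_antipodal_letters {θ : ℝ}
    (hθ : θ ∈ Set.Icc (π / 3) (2 * π / 3)) (Dl : List Face) (w c : Face) (hf : c ∈ Dl)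
    (hh : ((w.1 - 1, w.2) : Face) ∉ dom Dl) (hc : ∀ t, c.side t ≠ w.side .W)
    (hr : RootedFace (dom Dl) (w.side .W) c) {u : ℂ} (hu : u ≠ 0)
    (h2 : ∀ (ω : ΩG (dom Dl) (w.side .W) c) (h : ω.IsB2a),
      ω.WE (fun _ => θ) ≠ excursionWinding θ ω.2.firstSideG (ω.z1 hr h) ω.1 →
        ΩG.letterAt hh θ hr ω = u ∨ ΩG.letterAt hh θ hr ω = -u) :
    ((starRingEnd ℂ) u * vertexFunctional (printedWeights θ) tFiveEighths (ybCoeff θ) Dl (w.side .W) c).re = 0 ∧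
      ((starRingEnd ℂ) u * vertexFunctional (printedWeights θ) tFiveEighths (ybCoeff θ) Dl (w.side .W) c).im =
        weightV θ * Complex.normSq u * (ΩG.letterMass hh θ hr u - ΩG.letterMass hh θ hr (-u)) := by
  rw [vertexFunctional_printed_cell_eq_of_antipodal_letters hθ Dl w c hf hh hc hr hu h2]
  have key : (starRingEnd ℂ) u * (Complex.I * (weightV θ : ℂ) * u *
      ((ΩG.letterMass hh θ hr u : ℂ) - (ΩG.letterMass hh θ hr (-u) : ℂ))) =
      Complex.I * (((weightV θ * Complex.normSq u *
        (ΩG.letterMass hh θ hr u - ΩG.letterMass hh θ hr (-u)) : ℝ)) : ℂ) := by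
    push_cast
    rw [Complex.normSq_eq_conj_mul_self]
    ring
  rw [key]
  constructor
  · simp [Complex.mul_re]
  · simp [Complex.mul_im]

/-- ★★★ **KILL-FORCED ZEROS AT ANY TWO-ANTIPODAL-LETTER CELL.** Let `c` be a cell of the `W`-normalised hole root
`w.side W` at which, for every printed angle `θ`, the wound class-`B2a` walks realise only the two opposite letters `u(θ)`
and `−u(θ)`, with `u` continuous and non-vanishing on `[π/3, 2π/3]`. If at the honeycomb point every wound walk of letter
`u(π/3)` is `w₂`-marked while some wound walk of letter `−u(π/3)` is `w₂`-free, and at the dual point every wound walk of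
letter `−u(2π/3)` is `w₁`-marked while some wound walk of letter `u(2π/3)` is `w₁`-free, then the Yang–Baxter vertex
functional of the hole root vanishes EXACTLY at some `θ* ∈ (π/3, 2π/3)` at `c` — by the rotated line lemma applied to
`conj(u)·VF = i·v·‖u‖²·(M(u) − M(−u))`, negative at `π/3`, positive at `2π/3`. The far-cell, lateral and below-the-hole
theorems of §4, §6, §7 are the instances `u = ±i`, `u = e^{i(3θ/8 + 5π/8)}`, `u = e^{i·3θ/8}` written with route masses;
this form also serves the cells across multi-cell holes, where the catalogue has no route law.
[cite: GlazmanManolescu2019, Lemma 2.1 (statement, "in the form given in [Gl]")] [cite: GlazmanManolescu2019, §1 (the paragraph of Fig. 2 and the remark after eq. (1))]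
[cite: Glazman2015WeightedSAW, Lemma 3.1 (proof, pp. 6–7)] [cite: DuminilCopinSmirnov2012, proof of Lemma 1] -/
theorem vertexFunctional_printed_cell_exists_eq_zero_Ioo_of_antipodal_letters_of_opposite_kills
    (Dl : List Face) (w c : Face) (hf : c ∈ Dl) (hh : ((w.1 - 1, w.2) : Face) ∉ dom Dl)
    (hc : ∀ t, c.side t ≠ w.side .W) (hr : RootedFace (dom Dl) (w.side .W) c)
    (u : ℝ → ℂ) (hcu : ContinuousOn u (Set.Icc (π / 3) (2 * π / 3)))
    (hu0 : ∀ θ ∈ Set.Icc (π / 3) (2 * π / 3), u θ ≠ 0)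
    (h2 : ∀ θ ∈ Set.Icc (π / 3) (2 * π / 3), ∀ (ω : ΩG (dom Dl) (w.side .W) c) (h : ω.IsB2a),
      ω.WE (fun _ => θ) ≠ excursionWinding θ ω.2.firstSideG (ω.z1 hr h) ω.1 →
        ΩG.letterAt hh θ hr ω = u θ ∨ ΩG.letterAt hh θ hr ω = -u θ)
    (hK₂ : ∀ (ω : ΩG (dom Dl) (w.side .W) c) (h : ω.IsB2a),
      ω.WE (fun _ => π / 3) ≠ excursionWinding (π / 3) ω.2.firstSideG (ω.z1 hr h) ω.1 →
        ΩG.letterAt hh (π / 3) hr ω = u (π / 3) → ¬ω.2.W2FreeOff c)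
    (hF₂ : ∃ (ω : ΩG (dom Dl) (w.side .W) c) (h : ω.IsB2a),
      ω.WE (fun _ => π / 3) ≠ excursionWinding (π / 3) ω.2.firstSideG (ω.z1 hr h) ω.1 ∧
        ΩG.letterAt hh (π / 3) hr ω = -u (π / 3) ∧ ω.2.W2FreeOff c)
    (hK₁ : ∀ (ω : ΩG (dom Dl) (w.side .W) c) (h : ω.IsB2a),
      ω.WE (fun _ => 2 * π / 3) ≠ excursionWinding (2 * π / 3) ω.2.firstSideG (ω.z1 hr h) ω.1 →
        ΩG.letterAt hh (2 * π / 3) hr ω = -u (2 * π / 3) → ¬ω.2.W1FreeOff c)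
    (hF₁ : ∃ (ω : ΩG (dom Dl) (w.side .W) c) (h : ω.IsB2a),
      ω.WE (fun _ => 2 * π / 3) ≠ excursionWinding (2 * π / 3) ω.2.firstSideG (ω.z1 hr h) ω.1 ∧
        ΩG.letterAt hh (2 * π / 3) hr ω = u (2 * π / 3) ∧ ω.2.W1FreeOff c) :
    ∃ θ ∈ Set.Ioo (π / 3) (2 * π / 3),
      vertexFunctional (printedWeights θ) tFiveEighths (ybCoeff θ) Dl (w.side .W) c = 0 := by
  have hθ₁ : (π / 3 : ℝ) ∈ Set.Icc (π / 3) (2 * π / 3) := ⟨le_rfl, by linarith [Real.pi_pos]⟩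
  have hθ₂ : (2 * π / 3 : ℝ) ∈ Set.Icc (π / 3) (2 * π / 3) := ⟨by linarith [Real.pi_pos], le_rfl⟩
  have hv : ∀ θ ∈ Set.Icc (π / 3) (2 * π / 3), 0 < weightV θ := fun θ hθ =>
    weightV_pos_of_mem_Ioo ⟨by linarith [hθ.1, Real.pi_pos], by linarith [hθ.2, Real.pi_pos]⟩
  -- the rotated defect: real part zero, imaginary part v·‖u‖²·(M(u) − M(−u))
  have hreim : ∀ θ ∈ Set.Icc (π / 3) (2 * π / 3),
      ((starRingEnd ℂ) (u θ) * vertexFunctional (printedWeights θ) tFiveEighths (ybCoeff θ) Dl (w.side .W) c).re = 0 ∧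
        ((starRingEnd ℂ) (u θ) * vertexFunctional (printedWeights θ) tFiveEighths (ybCoeff θ) Dl (w.side .W) c).im =
          weightV θ * Complex.normSq (u θ) *
            (ΩG.letterMass hh θ hr (u θ) - ΩG.letterMass hh θ hr (-u θ)) := fun θ hθ =>
    re_im_conj_mul_vertexFunctional_printed_cell_of_antipodal_letters hθ Dl w c hf hh hc hr (hu0 θ hθ) (h2 θ hθ)
  -- the signs at the two ends
  have hΔ₁ : ΩG.letterMass hh (π / 3) hr (u (π / 3)) - ΩG.letterMass hh (π / 3) hr (-u (π / 3)) < 0 := by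
    rw [ΩG.letterMass_pi_div_three_eq_zero_of_killed hh hr (u (π / 3)) hK₂, zero_sub, neg_lt_zero]
    exact ΩG.letterMass_pi_div_three_pos_of_free hh hr (-u (π / 3)) hF₂
  have hΔ₂ : 0 < ΩG.letterMass hh (2 * π / 3) hr (u (2 * π / 3)) -
      ΩG.letterMass hh (2 * π / 3) hr (-u (2 * π / 3)) := by
    rw [ΩG.letterMass_two_pi_div_three_eq_zero_of_killed hh hr (-u (2 * π / 3)) hK₁, sub_zero]
    exact ΩG.letterMass_two_pi_div_three_pos_of_free hh hr (u (2 * π / 3)) hF₁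
  have him₁ : ((starRingEnd ℂ) (u (π / 3)) *
      vertexFunctional (printedWeights (π / 3)) tFiveEighths (ybCoeff (π / 3)) Dl (w.side .W) c).im < 0 := by
    rw [(hreim _ hθ₁).2]
    exact mul_neg_of_pos_of_neg (mul_pos (hv _ hθ₁) (Complex.normSq_pos.2 (hu0 _ hθ₁))) hΔ₁
  have him₂ : 0 < ((starRingEnd ℂ) (u (2 * π / 3)) *
      vertexFunctional (printedWeights (2 * π / 3)) tFiveEighths (ybCoeff (2 * π / 3)) Dl (w.side .W) c).im := by
    rw [(hreim _ hθ₂).2]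
    exact mul_pos (mul_pos (hv _ hθ₂) (Complex.normSq_pos.2 (hu0 _ hθ₂))) hΔ₂
  -- the rotated line lemma
  obtain ⟨θ, hθ, hz⟩ := vertexFunctional_printed_exists_eq_zero_of_rotated Dl (w.side .W) c
    (fun θ => (starRingEnd ℂ) (u θ)) (by linarith [Real.pi_pos]) (by linarith [Real.pi_pos])
    (by linarith [Real.pi_pos]) (Complex.continuous_conj.comp_continuousOn hcu)
    (fun θ hθ => by rw [map_ne_zero]; exact hu0 θ hθ) (fun θ hθ => (hreim θ hθ).1)
    (mul_nonpos_of_nonpos_of_nonneg him₁.le him₂.le)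
  -- the zero is not an end point
  have h1 : θ ≠ π / 3 := by
    rintro rfl; rw [hz, mul_zero, Complex.zero_im] at him₁; exact lt_irrefl _ him₁
  have h2' : θ ≠ 2 * π / 3 := by
    rintro rfl; rw [hz, mul_zero, Complex.zero_im] at him₂; exact lt_irrefl _ him₂
  exact ⟨θ, ⟨lt_of_le_of_ne hθ.1 (Ne.symm h1), lt_of_le_of_ne hθ.2 h2'⟩, hz⟩

end AntipodalLetters

end Literature.Barriers.CriticalPhenomena.PlaquetteWalk

end
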